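import Mathlib.MeasureTheory.Integral.MeanInequalities
import Literature.Analysis.FluidPDE.TsaiSelfSimilarPressure
import Literature.Analysis.FluidPDE.TsaiWeightedRieszPressure
import Literature.Analysis.FluidPDE.HelmholtzAnnihilator
import Literature.Analysis.FluidPDE.HarmonicProbe
import HarnessLib

/-!
# Tsai's weighted `L^{5/3}` pressure of a self-similar profile: the Liouville half, proved

Analysis/FluidPDE proofs file for the named fact `Literature.Analysis.FluidPDE.tsai1998_pressure_L53w`
(`FluidPDE/TsaiSelfSimilarPressure`; T.-P. Tsai, *On Leray's self-similar solutions of the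
Navier–Stokes equations satisfying local energy estimates*, Arch. Rational Mech. Anal. 143
(1998) 29–51, §4, pp. 45–46: a Leray profile `(U, P)` with
(4.3) `∫ |U|^{10/3} |y|^{-5/3} dy < ∞` has a constant `c` with
`∫ |P − c|^{5/3} |y|^{-5/3} ≤ C ∫ |U|^{10/3} |y|^{-5/3}`).

The printed argument (p. 45) has a harmonic-analysis half — `w = |y|^{-5/3} ∈ A_{5/3}(ℝ³)`,
"[St2, pp. 204–211]" (Stein 1993, Ch. V) makes `RᵢRⱼ` bounded on `L^{5/3}_w`, so
`P̃ := Σ RᵢRⱼ(UᵢUⱼ) ∈ L^{5/3}_w` with `‖P̃‖_{w,5/3} ≤ C Σ ‖UᵢUⱼ‖_{w,5/3}` solves (2.1)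
`−ΔP̃ = ∂ᵢ∂ⱼ(UᵢUⱼ)` in `𝒟'` — and a Liouville half — "following the proof of Lemma 2.1, we want
to show that `P̃` differs from `P` only by a constant": Weyl's lemma, the harmonic vector field
`F = −νΔU + aU + a(y·∇)U + (U·∇)U + ∇P̃ = ∇P̃ − ∇P`, and `D^αF(0) = 0` by testing against the
rescaled radial bumps `ε^{3+|α|}(D^αφ)(εy)` with the weighted Hölder inequality
("`≤ Cε^{3+|α|} · ε^{−13/5}` … as `ε` goes to zero, this term goes to zero", pp. 45–46). The
first half is genuine weighted Calderón–Zygmund theory and is the named fact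
`tsai1998_weightedRieszPressure` (`FluidPDE/TsaiWeightedRieszPressure`). **This file proves the
second half and the reduction**

  `tsai1998_pressure_L53w_of_weightedRiesz : tsai1998_weightedRieszPressure → tsai1998_pressure_L53w`,

so that the fact is discharged as soon as the weighted Riesz bound is.

## The proof (Tsai's Lemma 2.1 argument, run on mollifications)

Let `Q = P̃ ∈ L^{5/3}_w` be the function provided by the hypothesis and `g = P − Q`.

* §1 *Weighted Hölder on balls*: `∫_{|x|≤ϱ} |F| ≤ (∫ |F|^p |x|^{-α})^{1/p} (ϱ^{αq/p}|B_ϱ|)^{1/q}`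
  (`lintegral_enorm_closedBall_le_weighted`); hence `Q ∈ L¹_loc`, `∫_{B_ϱ} |U| ≲ ϱ^{13/5}`,
  `∫_{B_ϱ} |U|² ≲ ϱ^{11/5}`, `∫_{B_ϱ} |Q| ≲ ϱ^{11/5}` — the powers `ε^{−13/5}` of p. 45.
* §2 *Testing the profile system* (`U ∈ C²`, `P ∈ C¹`, so everything is done weakly): for
  `θ ∈ C²_c`, `∫ θ ∂ₑP = ν ∫ Δθ ⟪U,e⟫ + 2a ∫ θ ⟪U,e⟫ + a ∫ (x·∇θ) ⟪U,e⟫ + ∫ (U·∇θ) ⟪U,e⟫`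
  (`IsLerayProfile.integral_mul_fderiv_pressure`: the integrations by parts of p. 35 for the
  terms `ΔU`, `(y·∇)U`, `(U·∇)U`), and the weak pressure Poisson equation (2.1)/(2.5)
  `∫ P Δφ = −∫ D²φ(U, U)`
  (`IsLerayProfile.integral_pressure_mul_laplacian_eq_neg_integral_hessian`). Hence `g` is weakly
  harmonic: `∫ g Δφ = 0`.
* §3 *Weyl / mean value*: the mollifications `η = ψ ⋆ g` are smooth harmonic functions
  (`Δ(ψ ⋆ g) = ∫ Δ(ψ(x − ·)) g = 0`, the easy half of Weyl's lemma, as in the tree's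
  `FluidPDE/HelmholtzAnnihilator`), and by the mean-value formula for the gradient against the
  radial probes `χ_R` of `FluidPDE/HarmonicProbe` and associativity of convolution,
  `∂ₑη(y) = ∫ ∂ₑΨ(y − x) g(x) dx`, `Ψ = χ_R ⋆ ψ` (`fderiv_convolution_eq_integral_probe`) — the
  tree's rendering of `D^αF(0) = (−1)^{|α|}∫ F ε^{3+|α|}(D^αφ)(εy) dy`, `|α| = 1`, `ε = R⁻¹`.
* §4 *The estimate*: split `g = P − Q`, move `∂ₑ` onto `P` and apply §2 with `θ = Ψ(y − ·)`;
  the five terms are bounded by `|Ψ| ≲ R⁻³`, `|∇Ψ| ≲ R⁻⁴`, `|ΔΨ| ≲ R⁻⁵` times the ball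
  integrals of §1 over `{|x| ≤ ‖y‖ + 2R + r_ψ}`, each `O(R^{-2/5})`
  (`IsLerayProfile.abs_fderiv_normed_convolution_sub_le`); letting `R → ∞`, `∇η ≡ 0`
  (`IsLerayProfile.fderiv_normed_convolution_sub_eq_zero`).
* §5 Each `φₖ ⋆ g` is therefore constant, and `φₖ ⋆ g → g` a.e. along a mollifier sequence
  (Lebesgue differentiation), so `P − Q = c` a.e. (`IsLerayProfile.exists_sub_ae_eq_const`);
  finally `∫ |P − c|^{5/3} w = ∫ |Q|^{5/3} w ≤ C ∫ |U|^{10/3} w`.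

Analyticity of `F` (used in print to pass from `D^αF(0) = 0` to `F ≡ 0`) is avoided by running
the `|α| = 1` estimate at every centre `y`; Weyl's lemma is only needed for mollifications.

## Mathlib / tree tools

Mathlib: `MeasureTheory.convolution_assoc`, `HasCompactSupport.contDiff_convolution_left`,
`ContDiffBump.normed` and `ContDiffBump.ae_convolution_tendsto_right_of_locallyIntegrable` (via
the tree's `FunctionSpaces.ae_tendsto_normed_convolution`), `ENNReal.lintegral_mul_le_Lp_mul_Lq`
(Hölder), `is_const_of_fderiv_eq_zero`, `Measure.addHaar_closedBall`. Tree: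
`FluidPDE/HarmonicProbe` (`probeBump`, `fderiv_harmonic_eq_integral_probeBump`, derivative
bounds), `FluidPDE/HelmholtzAnnihilator` (`laplacian_convolution_lsmul`,
`fderiv_convolution_lsmul_apply`, `laplacian_comp_sub_left`, `fderiv_laplacian_apply`),
`FluidPDE/WholeSpaceIBP` (Green and trilinear identities), `FluidPDE/PressurePoisson`
(`fderiv_apply_const_apply`), `FunctionSpaces/Mollification` (test-function API, mollifier
sequence).

## References

* T.-P. Tsai, *On Leray's self-similar solutions of the Navier–Stokes equations satisfying local
  energy estimates*, Arch. Rational Mech. Anal. 143 (1998) 29–51: Lemma 2.1 and its proof,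
  (2.1), (2.5), (2.6) (pp. 34–36); §4, (4.3) and pp. 45–46 [Tsai1998].
* E. M. Stein, *Harmonic Analysis* (1993), Ch. V §4.2, §6.4 (the hypothesis) [SteinHA1993].
* D. Gilbarg, N. S. Trudinger, *Elliptic partial differential equations of second order*, Thm 2.1
  (mean value property) [GilbargTrudinger2001].
* L. C. Evans, *Partial Differential Equations*, 2nd ed., App. C.4, Thm 7 (mollifiers)
  [Evans2010].
-/

noncomputable section

open MeasureTheory Set Filter Metric Topology InnerProductSpace Function ContinuousLinearMap
open scoped ENNReal NNReal RealInnerProductSpace ContDiff Laplacian Convolution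

namespace Literature.Analysis.FluidPDE

/-- Local notation for physical space `ℝ³ = EuclideanSpace ℝ (Fin 3)`. -/
local notation "ℝ³" => EuclideanSpace ℝ (Fin 3)

/-! ## §1. Weighted Hölder inequalities on balls -/

section WeightedHolder

variable {G : Type*} [NormedAddCommGroup G]

/-- **Weighted Hölder on a ball, `lintegral` form.** For conjugate exponents `p, q`, a weight
exponent `α > 0` and a radius `ϱ > 0`:
`∫_{|x| ≤ ϱ} |F| ≤ (∫ |F|^p |x|^{-α})^{1/p} (ϱ^{αq/p} |B_ϱ|)^{1/q}`
(write `|F| = (|F| |x|^{-α/p}) · |x|^{α/p}` off the origin and bound `|x|^{αq/p} ≤ ϱ^{αq/p}` on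
the ball; Tsai 1998, p. 45, the Hölder step of the displayed estimate). [cite: Tsai1998, §4 p. 45] -/
theorem lintegral_enorm_closedBall_le_weighted {F : ℝ³ → G} (hF : AEStronglyMeasurable F volume)
    {p q : ℝ} (hpq : p.HolderConjugate q) {α : ℝ} (hα : 0 < α) (ϱ : ℝ) :
    ∫⁻ x in closedBall (0 : ℝ³) ϱ, ‖F x‖ₑ ≤
      (∫⁻ x, ‖F x‖ₑ ^ p * ‖x‖ₑ ^ (-α)) ^ (1 / p) *
        (ENNReal.ofReal ϱ ^ (α * q / p) * volume (closedBall (0 : ℝ³) ϱ)) ^ (1 / q) := by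
  have hp : 0 < p := hpq.left_pos
  have hq : 0 < q := hpq.right_pos
  set μ : Measure ℝ³ := volume.restrict (closedBall (0 : ℝ³) ϱ) with hμ
  set f : ℝ³ → ℝ≥0∞ := fun x => ‖F x‖ₑ * ‖x‖ₑ ^ (-(α / p)) with hf
  set g : ℝ³ → ℝ≥0∞ := fun x => ‖x‖ₑ ^ (α / p) with hg
  -- off the origin `‖F x‖ₑ = f x * g x`
  have h0 : ∀ᵐ x ∂μ, x ≠ (0 : ℝ³) := by
    refine ae_restrict_of_ae ?_
    have : ({(0 : ℝ³)} : Set ℝ³)ᶜ ∈ ae (volume : Measure ℝ³) :=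
      compl_mem_ae_iff.2 (measure_singleton _)
    filter_upwards [this] with x hx
    simpa using hx
  have hsplit : ∀ᵐ x ∂μ, ‖F x‖ₑ = (f * g) x := by
    filter_upwards [h0] with x hx
    have h1 : ‖x‖ₑ ≠ 0 := by simpa using hx
    have h2 : ‖x‖ₑ ≠ ⊤ := enorm_ne_top
    simp only [hf, hg, Pi.mul_apply]
    rw [mul_assoc, ← ENNReal.rpow_add _ _ h1 h2, neg_add_cancel, ENNReal.rpow_zero, mul_one]
  have hfm : AEMeasurable f μ := by
    simp only [hf]
    exact (hF.restrict.enorm).mul (by fun_prop)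
  have hgm : AEMeasurable g μ := by
    simp only [hg]; fun_prop
  calc ∫⁻ x in closedBall (0 : ℝ³) ϱ, ‖F x‖ₑ = ∫⁻ x, (f * g) x ∂μ := lintegral_congr_ae hsplit
    _ ≤ (∫⁻ x, f x ^ p ∂μ) ^ (1 / p) * (∫⁻ x, g x ^ q ∂μ) ^ (1 / q) :=
        ENNReal.lintegral_mul_le_Lp_mul_Lq μ hpq hfm hgm
    _ ≤ (∫⁻ x, ‖F x‖ₑ ^ p * ‖x‖ₑ ^ (-α)) ^ (1 / p) *
        (ENNReal.ofReal ϱ ^ (α * q / p) * volume (closedBall (0 : ℝ³) ϱ)) ^ (1 / q) := by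
        gcongr ?_ ^ _ * ?_ ^ _
        · -- `∫_B f^p ≤ ∫ |F|^p |x|^{-α}`
          calc ∫⁻ x, f x ^ p ∂μ ≤ ∫⁻ x, f x ^ p := setLIntegral_le_lintegral _ _
            _ = ∫⁻ x, ‖F x‖ₑ ^ p * ‖x‖ₑ ^ (-α) := by
                refine lintegral_congr fun x => ?_
                simp only [hf]
                rw [ENNReal.mul_rpow_of_nonneg _ _ hp.le, ← ENNReal.rpow_mul]
                congr 2
                field_simp
        · -- `∫_B g^q ≤ ϱ^{αq/p} |B|`
          calc ∫⁻ x, g x ^ q ∂μ ≤ ∫⁻ _ in closedBall (0 : ℝ³) ϱ, ENNReal.ofReal ϱ ^ (α * q / p) := by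
                refine setLIntegral_mono measurable_const fun x hx => ?_
                simp only [hg]
                rw [← ENNReal.rpow_mul, show α / p * q = α * q / p by ring]
                refine ENNReal.rpow_le_rpow ?_ (by positivity)
                rw [← ofReal_norm]
                exact ENNReal.ofReal_le_ofReal (mem_closedBall_zero_iff.1 hx)
            _ = ENNReal.ofReal ϱ ^ (α * q / p) * volume (closedBall (0 : ℝ³) ϱ) :=
                setLIntegral_const _ _

/-- **Weighted Hölder on a ball, real form.** Under `∫ |F|^p |x|^{-α} < ∞` (`p, q` conjugate,
`α > 0`), `F` is integrable on every ball `B_ϱ = {|x| ≤ ϱ}`, `ϱ > 0`, and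
`∫_{B_ϱ} |F| ≤ A ϱ^{α/p + 3/q}` with `A = (∫ |F|^p |x|^{-α})^{1/p} |B₁|^{1/q}` independent of `ϱ`
(`|B_ϱ| = ϱ³ |B₁|` on `ℝ³`; Tsai 1998, p. 45, the powers of `ε` in the displayed estimate).
[cite: Tsai1998, §4 p. 45] -/
theorem setIntegral_norm_closedBall_le_weighted {F : ℝ³ → G} (hF : AEStronglyMeasurable F volume)
    {p q : ℝ} (hpq : p.HolderConjugate q) {α : ℝ} (hα : 0 < α)
    (hI : ∫⁻ x, ‖F x‖ₑ ^ p * ‖x‖ₑ ^ (-α) ≠ ⊤) {ϱ : ℝ} (hϱ : 0 < ϱ) :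
    IntegrableOn F (closedBall (0 : ℝ³) ϱ) ∧
      ∫ x in closedBall (0 : ℝ³) ϱ, ‖F x‖ ≤
        ((∫⁻ x, ‖F x‖ₑ ^ p * ‖x‖ₑ ^ (-α)) ^ (1 / p) *
            volume (ball (0 : ℝ³) 1) ^ (1 / q)).toReal * ϱ ^ (α / p + 3 / q) := by
  have hp : 0 < p := hpq.left_pos
  have hq : 0 < q := hpq.right_pos
  have key := lintegral_enorm_closedBall_le_weighted hF hpq hα ϱ
  have hvol : volume (closedBall (0 : ℝ³) ϱ) = ENNReal.ofReal (ϱ ^ 3) * volume (ball (0 : ℝ³) 1) := by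
    rw [Measure.addHaar_closedBall _ _ hϱ.le, finrank_euclideanSpace_fin]
  have hϱ0 : ENNReal.ofReal ϱ ≠ 0 := by simpa using hϱ
  have hrhs : (ENNReal.ofReal ϱ ^ (α * q / p) * volume (closedBall (0 : ℝ³) ϱ)) ^ (1 / q) =
      volume (ball (0 : ℝ³) 1) ^ (1 / q) * ENNReal.ofReal (ϱ ^ (α / p + 3 / q)) := by
    rw [hvol, ENNReal.ofReal_pow hϱ.le, ← ENNReal.rpow_natCast, ← mul_assoc,
      ← ENNReal.rpow_add _ _ hϱ0 ENNReal.ofReal_ne_top,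
      ENNReal.mul_rpow_of_nonneg _ _ (by positivity : (0 : ℝ) ≤ 1 / q), ← ENNReal.rpow_mul,
      ENNReal.ofReal_rpow_of_pos hϱ, mul_comm]
    congr 2
    push_cast
    field_simp
  set A : ℝ≥0∞ := (∫⁻ x, ‖F x‖ₑ ^ p * ‖x‖ₑ ^ (-α)) ^ (1 / p) * volume (ball (0 : ℝ³) 1) ^ (1 / q)
    with hA_def
  have hA : A ≠ ⊤ :=
    ENNReal.mul_ne_top (ENNReal.rpow_ne_top_of_nonneg (by positivity) hI)
      (ENNReal.rpow_ne_top_of_nonneg (by positivity) measure_ball_lt_top.ne)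
  have hbound : ∫⁻ x in closedBall (0 : ℝ³) ϱ, ‖F x‖ₑ ≤ A * ENNReal.ofReal (ϱ ^ (α / p + 3 / q)) := by
    refine key.trans_eq ?_
    rw [hrhs, hA_def, mul_assoc]
  have hfin : ∫⁻ x in closedBall (0 : ℝ³) ϱ, ‖F x‖ₑ < ⊤ :=
    hbound.trans_lt (ENNReal.mul_lt_top hA.lt_top ENNReal.ofReal_lt_top)
  refine ⟨⟨hF.restrict, hfin⟩, ?_⟩
  rw [integral_norm_eq_lintegral_enorm hF.restrict]
  have h := ENNReal.toReal_mono (ENNReal.mul_ne_top hA ENNReal.ofReal_ne_top) hbound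
  rwa [ENNReal.toReal_mul, ENNReal.toReal_ofReal (by positivity)] at h

/-- A function in a weighted space `L^p(|x|^{-α} dx)`, `1 < p < ∞`, `α > 0`, is locally
integrable for Lebesgue measure (Hölder on balls). [cite: Tsai1998, §4 p. 45] -/
theorem locallyIntegrable_of_weighted {F : ℝ³ → G} (hF : AEStronglyMeasurable F volume)
    {p q : ℝ} (hpq : p.HolderConjugate q) {α : ℝ} (hα : 0 < α)
    (hI : ∫⁻ x, ‖F x‖ₑ ^ p * ‖x‖ₑ ^ (-α) ≠ ⊤) : LocallyIntegrable F volume := by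
  refine locallyIntegrable_iff.2 fun k hk => ?_
  obtain ⟨ϱ, hϱ⟩ := hk.isBounded.subset_closedBall (0 : ℝ³)
  have h1 : (0 : ℝ) < max ϱ 1 := lt_max_of_lt_right one_pos
  exact ((setIntegral_norm_closedBall_le_weighted hF hpq hα hI h1).1).mono_set
    (hϱ.trans (closedBall_subset_closedBall (le_max_left _ _)))

end WeightedHolder

/-! ## §2. Testing the profile system: the pressure gradient against a test function -/

section ProfileCalculus

variable {ν a : ℝ} {U : ℝ³ → ℝ³} {P : ℝ³ → ℝ}

/-- The profile equation solved for the pressure gradient: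
`∇P = νΔU − aU − a(y·∇)U − (U·∇)U`. [cite: Tsai1998, (1.3)] -/
theorem IsLerayProfile.gradient_eq (hprof : IsLerayProfile ν a U P) (x : ℝ³) :
    gradient P x = ν • (Δ U) x - a • U x - a • fderiv ℝ U x x - convect U U x := by
  have h := hprof.profile_eq x
  rw [eq_neg_of_add_eq_zero_right h]
  abel

/-- `∂ₑP = ⟪∇P, e⟫`. [folklore] -/
theorem fderiv_eq_inner_gradient (P : ℝ³ → ℝ) (x e : ℝ³) : fderiv ℝ P x e = ⟪gradient P x, e⟫ := by
  rw [gradient, InnerProductSpace.toDual_symm_apply]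

/-- **Green's second identity against `θ e`**: for `U ∈ C²`, `θ ∈ C²_c` and a fixed vector `e`,
`∫ θ ⟪ΔU, e⟫ = ∫ Δθ ⟪U, e⟫`. [folklore] -/
theorem integral_mul_inner_laplacian_eq (hU : ContDiff ℝ 2 U) {θ : ℝ³ → ℝ} (hθ : ContDiff ℝ 2 θ)
    (hθc : HasCompactSupport θ) (e : ℝ³) :
    ∫ x, θ x * ⟪(Δ U) x, e⟫ = ∫ x, (Δ θ) x * ⟪U x, e⟫ := by
  set b := stdOrthonormalBasis ℝ ℝ³
  set L : ℝ →L[ℝ] ℝ³ := (ContinuousLinearMap.id ℝ ℝ).smulRight e with hL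
  set w : ℝ³ → ℝ³ := fun x => θ x • e with hw
  have hw_eq : w = L ∘ θ := by
    funext x; simp [hw, hL]
  have hw2 : ContDiff ℝ 2 w := hθ.smul contDiff_const
  have hwc : HasCompactSupport w := hθc.smul_right (f' := fun _ : ℝ³ => e)
  have h1 := integral_inner_laplacian_add_eq_zero b hU (hw2.of_le one_le_two) (Or.inr hwc)
  have h2 := integral_inner_laplacian_add_eq_zero b hw2 (hU.of_le one_le_two) (Or.inl hwc)
  have hsum : ∑ i, ∫ x, ⟪fderiv ℝ U x (b i), fderiv ℝ w x (b i)⟫ =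
      ∑ i, ∫ x, ⟪fderiv ℝ w x (b i), fderiv ℝ U x (b i)⟫ :=
    Finset.sum_congr rfl fun i _ => integral_congr_ae (ae_of_all _ fun x => real_inner_comm _ _)
  have hΔw : ∀ x, (Δ w) x = (Δ θ) x • e := fun x => by
    rw [hw_eq, ContDiffAt.laplacian_CLM_comp_left hθ.contDiffAt]
    simp [hL]
  calc ∫ x, θ x * ⟪(Δ U) x, e⟫ = ∫ x, ⟪(Δ U) x, w x⟫ :=
        integral_congr_ae (ae_of_all _ fun x => by simp only [hw]; rw [real_inner_smul_right])
    _ = ∫ x, ⟪(Δ w) x, U x⟫ := by linarith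
    _ = ∫ x, (Δ θ) x * ⟪U x, e⟫ := by
        refine integral_congr_ae (ae_of_all _ fun x => ?_)
        dsimp only
        rw [hΔw, real_inner_smul_left, real_inner_comm]

/-- The derivative of `x ↦ θ(x) e` is `h ↦ (Dθ(x) h) e`. [folklore] -/
theorem fderiv_smul_const_apply' {θ : ℝ³ → ℝ} (hθ : ContDiff ℝ 1 θ) (e x h : ℝ³) :
    fderiv ℝ (fun y => θ y • e) x h = fderiv ℝ θ x h • e := by
  rw [fderiv_smul_const (hθ.differentiable one_ne_zero x)]
  simp

/-- **The drift term**: `∫ θ ⟪(x·∇)U, e⟫ = -∫ (x·∇θ) ⟪U, e⟫ - 3 ∫ θ ⟪U, e⟫` for `U ∈ C¹`,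
`θ ∈ C¹_c` (integration by parts; `div x = 3` on `ℝ³`). [cite: Tsai1998, Lemma 2.1 (p. 35, the term (y·∇)U)] -/
theorem integral_mul_inner_fderiv_self_eq (hU : ContDiff ℝ 1 U) {θ : ℝ³ → ℝ} (hθ : ContDiff ℝ 1 θ)
    (hθc : HasCompactSupport θ) (e : ℝ³) :
    ∫ x, θ x * ⟪fderiv ℝ U x x, e⟫ =
      -(∫ x, fderiv ℝ θ x x * ⟪U x, e⟫) - 3 * ∫ x, θ x * ⟪U x, e⟫ := by
  set w : ℝ³ → ℝ³ := fun x => θ x • e with hw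
  have hw1 : ContDiff ℝ 1 w := hθ.smul contDiff_const
  have hwc : HasCompactSupport w := hθc.smul_right (f' := fun _ : ℝ³ => e)
  have h := integral_inner_convect_add_eq_zero (u := fun x : ℝ³ => x) (v := U) (w := w)
    contDiff_id hU hw1 hwc
  have hdiv : ∀ x : ℝ³, VectorCalculus.divergence (fun x : ℝ³ => x) x = 3 := fun x => by
    rw [VectorCalculus.divergence, fderiv_fun_id, ContinuousLinearMap.coe_id, LinearMap.trace_id,
      finrank_euclideanSpace_fin]
    norm_num
  have e1 : ∫ x, ⟪convect (fun x : ℝ³ => x) U x, w x⟫ = ∫ x, θ x * ⟪fderiv ℝ U x x, e⟫ :=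
    integral_congr_ae (ae_of_all _ fun x => by simp only [convect, hw]; rw [real_inner_smul_right])
  have e2 : ∫ x, ⟪U x, convect (fun x : ℝ³ => x) w x⟫ = ∫ x, fderiv ℝ θ x x * ⟪U x, e⟫ :=
    integral_congr_ae (ae_of_all _ fun x => by
      simp only [convect, hw]
      rw [fderiv_smul_const_apply' hθ, real_inner_smul_right])
  have e3 : ∫ x, VectorCalculus.divergence (fun x : ℝ³ => x) x * ⟪U x, w x⟫ =
      3 * ∫ x, θ x * ⟪U x, e⟫ := by
    rw [← integral_const_mul]
    refine integral_congr_ae (ae_of_all _ fun x => ?_)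
    simp only [hw]
    rw [hdiv, real_inner_smul_right]
  rw [e1, e2, e3] at h
  linarith

/-- **The convection term**: `∫ θ ⟪(U·∇)U, e⟫ = -∫ (U·∇θ) ⟪U, e⟫` for a divergence-free
`U ∈ C¹` and `θ ∈ C¹_c`. [cite: Tsai1998, Lemma 2.1 (p. 35)] -/
theorem integral_mul_inner_convect_eq (hU : ContDiff ℝ 1 U) (hdiv : VectorCalculus.IsDivFree U)
    {θ : ℝ³ → ℝ} (hθ : ContDiff ℝ 1 θ) (hθc : HasCompactSupport θ) (e : ℝ³) :
    ∫ x, θ x * ⟪convect U U x, e⟫ = -∫ x, fderiv ℝ θ x (U x) * ⟪U x, e⟫ := by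
  set w : ℝ³ → ℝ³ := fun x => θ x • e with hw
  have hw1 : ContDiff ℝ 1 w := hθ.smul contDiff_const
  have hwc : HasCompactSupport w := hθc.smul_right (f' := fun _ : ℝ³ => e)
  have h := integral_inner_convect_add_eq_zero (u := U) (v := U) (w := w) hU hU hw1 hwc
  have e1 : ∫ x, ⟪convect U U x, w x⟫ = ∫ x, θ x * ⟪convect U U x, e⟫ :=
    integral_congr_ae (ae_of_all _ fun x => by simp only [hw]; rw [real_inner_smul_right])
  have e2 : ∫ x, ⟪U x, convect U w x⟫ = ∫ x, fderiv ℝ θ x (U x) * ⟪U x, e⟫ :=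
    integral_congr_ae (ae_of_all _ fun x => by
      simp only [convect, hw]
      rw [fderiv_smul_const_apply' hθ, real_inner_smul_right])
  have e3 : ∫ x, VectorCalculus.divergence U x * ⟪U x, w x⟫ = 0 := by
    simp [hdiv _]
  rw [e1, e2, e3] at h
  linarith

/-- **The pressure gradient of a Leray profile against a test function** (the integrations by
parts of Tsai's Lemma 2.1 applied to `F = −νΔU + aU + a(y·∇)U + (U·∇)U + ∇P = 0`): for a Leray
profile `(U, P)`, `θ ∈ C²_c` and a fixed vector `e`,
`∫ θ ∂ₑP = ν ∫ Δθ ⟪U, e⟫ + 2a ∫ θ ⟪U, e⟫ + a ∫ (x·∇θ) ⟪U, e⟫ + ∫ (U·∇θ) ⟪U, e⟫`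
— every derivative has been moved onto `θ`. [cite: Tsai1998, Lemma 2.1 (pp. 35–36) and §4 p. 45] -/
theorem IsLerayProfile.integral_mul_fderiv_pressure (hprof : IsLerayProfile ν a U P)
    {θ : ℝ³ → ℝ} (hθ : ContDiff ℝ 2 θ) (hθc : HasCompactSupport θ) (e : ℝ³) :
    ∫ x, θ x * fderiv ℝ P x e =
      ν * (∫ x, (Δ θ) x * ⟪U x, e⟫) + 2 * a * (∫ x, θ x * ⟪U x, e⟫) +
        a * (∫ x, fderiv ℝ θ x x * ⟪U x, e⟫) + ∫ x, fderiv ℝ θ x (U x) * ⟪U x, e⟫ := by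
  have hU2 := hprof.contDiff_velocity
  have hU1 : ContDiff ℝ 1 U := hU2.of_le one_le_two
  have hθ1 : ContDiff ℝ 1 θ := hθ.of_le one_le_two
  -- continuity of the four velocity terms
  have cΔ : Continuous (Δ U) := FluidPDE.continuous_laplacian hU2
  have cD : Continuous fun x => fderiv ℝ U x x := (hU1.continuous_fderiv one_ne_zero).clm_apply continuous_id
  have cC : Continuous (convect U U) := (hU1.continuous_fderiv one_ne_zero).clm_apply hU1.continuous
  -- integrability of `θ ⟪X, e⟫` for continuous `X`
  have hint : ∀ {X : ℝ³ → ℝ³}, Continuous X → Integrable fun x => θ x * ⟪X x, e⟫ := fun hX =>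
    (hθ.continuous.mul (hX.inner continuous_const)).integrable_of_hasCompactSupport hθc.mul_right
  -- substitute the profile equation
  have hpt : ∀ x, θ x * fderiv ℝ P x e =
      ν * (θ x * ⟪(Δ U) x, e⟫) - a * (θ x * ⟪U x, e⟫) - a * (θ x * ⟪fderiv ℝ U x x, e⟫) -
        θ x * ⟪convect U U x, e⟫ := fun x => by
    rw [fderiv_eq_inner_gradient, hprof.gradient_eq]
    simp only [inner_sub_left, real_inner_smul_left]
    ring
  simp_rw [hpt]
  have i1 : Integrable fun x => ν * (θ x * ⟪(Δ U) x, e⟫) := (hint cΔ).const_mul ν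
  have i2 : Integrable fun x => a * (θ x * ⟪U x, e⟫) := (hint hU1.continuous).const_mul a
  have i3 : Integrable fun x => a * (θ x * ⟪fderiv ℝ U x x, e⟫) := (hint cD).const_mul a
  rw [integral_sub ((i1.sub' i2).sub' i3) (hint cC), integral_sub (i1.sub' i2) i3,
    integral_sub i1 i2, integral_const_mul, integral_const_mul, integral_const_mul,
    integral_mul_inner_laplacian_eq hU2 hθ hθc, integral_mul_inner_fderiv_self_eq hU1 hθ1 hθc,
    integral_mul_inner_convect_eq hU1 hprof.divFree hθ1 hθc]
  ring

/-- **Divergence-free fields annihilate gradients, coordinate form**: for a divergence-free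
`U ∈ C¹`, `g ∈ C¹_c` and an orthonormal basis `b`, `Σᵢ ∫ ∂ᵢg ⟪U, bᵢ⟫ = ∫ ⟪U, ∇g⟫ = 0`. [folklore] -/
theorem sum_integral_fderiv_mul_inner_eq_zero {ι : Type*} [Fintype ι] (b : OrthonormalBasis ι ℝ ℝ³)
    (hU : ContDiff ℝ 1 U) (hdiv : VectorCalculus.IsDivFree U) {g : ℝ³ → ℝ} (hg : ContDiff ℝ 1 g)
    (hgc : HasCompactSupport g) :
    ∑ i, ∫ x, fderiv ℝ g x (b i) * ⟪U x, b i⟫ = 0 := by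
  have hint : ∀ i, Integrable fun x => fderiv ℝ g x (b i) * ⟪U x, b i⟫ := fun i =>
    (((hg.continuous_fderiv one_ne_zero).clm_apply continuous_const).mul
      (hU.continuous.inner continuous_const)).integrable_of_hasCompactSupport
      ((hgc.fderiv_apply (𝕜 := ℝ) (b i)).mul_right)
  rw [← integral_finsetSum _ fun i _ => hint i]
  have hpt : ∀ x, ∑ i, fderiv ℝ g x (b i) * ⟪U x, b i⟫ = ⟪U x, gradient g x⟫ := fun x => by
    rw [real_inner_comm, ← fderiv_eq_inner_gradient]
    conv_rhs => rw [← b.sum_repr' (U x)]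
    rw [map_sum]
    refine Finset.sum_congr rfl fun i _ => ?_
    rw [map_smul, smul_eq_mul, real_inner_comm, mul_comm]
  simp_rw [hpt]
  have h := integral_mul_divergence_add_eq_zero_left hg hU hgc
  have h0 : ∫ x, g x * VectorCalculus.divergence U x = 0 := by simp [hdiv _]
  linarith

/-- **The weak pressure Poisson equation of a Leray profile** (Tsai 1998, (2.1): "We take the
divergence of (1.3) and formally deduce that `−ΔP = Σ ∂ᵢ∂ⱼ(UᵢUⱼ)`"), in the distributional form
(2.5) and for the tree's pointwise class (`U ∈ C²`, `P ∈ C¹`, so only the weak form makes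
sense): `∫ P Δφ = −∫ D²φ(U, U)` for every `φ ∈ C_c^∞(ℝ³)`. Proof: `∫ P Δφ = −Σᵢ ∫ ∂ᵢφ ∂ᵢP`,
then `integral_mul_fderiv_pressure` with `θ = ∂ᵢφ`, `e = bᵢ`, and summation: the `ΔU`, `U` and
`(y·∇)U` contributions are pairings of the divergence-free `U` with the gradients `∇Δφ`, `∇φ`,
`∇(y·∇φ) − ∇φ` and vanish, the convection term gives `Σᵢⱼ ∫ UᵢUⱼ ∂ᵢ∂ⱼφ`. (The sibling
`IsLerayProfile.integral_pressure_mul_laplacian` of `FluidPDE/LerayProfileWeakPressure` is the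
coordinate form `∫ P Σᵢ∂ᵢ∂ᵢψ = −∫ (Σᵢⱼ ∂ᵢUⱼ∂ⱼUᵢ) ψ` against complex test functions; here the
derivatives stay on the test function, as (2.5) and the `L^{5/3}_w` theory require.)
[cite: Tsai1998, (2.1) and (2.5) (p. 34)] -/
theorem IsLerayProfile.integral_pressure_mul_laplacian_eq_neg_integral_hessian (hprof : IsLerayProfile ν a U P)
    {φ : ℝ³ → ℝ} (hφ : ContDiff ℝ (⊤ : ℕ∞) φ) (hφc : HasCompactSupport φ) :
    ∫ x, P x * (Δ φ) x = -∫ x, fderiv ℝ (fderiv ℝ φ) x (U x) (U x) := by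
  set b := stdOrthonormalBasis ℝ ℝ³
  have hφ2 : ContDiff ℝ 2 φ := contDiff_infty.1 hφ 2
  have hφ3 : ContDiff ℝ 3 φ := contDiff_infty.1 hφ 3
  have hφ1 : ContDiff ℝ 1 φ := contDiff_infty.1 hφ 1
  have hP1 := hprof.contDiff_pressure
  have hU2 := hprof.contDiff_velocity
  have hU1 : ContDiff ℝ 1 U := hU2.of_le one_le_two
  have hDφ2 : ContDiff ℝ 2 (fderiv ℝ φ) := hφ3.fderiv_right (m := 2) (by norm_cast)
  have hDDφ : ∀ x, DifferentiableAt ℝ (fderiv ℝ φ) x := fun x => hDφ2.differentiable (by norm_num) x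
  -- the partial derivatives `θᵢ = ∂ᵢφ`
  set θ : Fin (Module.finrank ℝ ℝ³) → ℝ³ → ℝ := fun i x => fderiv ℝ φ x (b i) with hθ_def
  have hθ : ∀ i, ContDiff ℝ 2 (θ i) := fun i => hDφ2.clm_apply contDiff_const
  have hθ1 : ∀ i, ContDiff ℝ 1 (θ i) := fun i => (hθ i).of_le one_le_two
  have hθc : ∀ i, HasCompactSupport (θ i) := fun i => hφc.fderiv_apply (𝕜 := ℝ) (b i)
  -- step 1: `∫ P Δφ = Σᵢ ∫ P ∂ᵢθᵢ = -Σᵢ ∫ θᵢ ∂ᵢP`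
  have hΔ : ∀ x, (Δ φ) x = ∑ i, fderiv ℝ (θ i) x (b i) := fun x =>
    laplacian_eq_sum_fderiv_fderiv b hφ2 x
  have hI1 : ∀ i, Integrable fun x => P x * fderiv ℝ (θ i) x (b i) := fun i =>
    (hP1.continuous.mul (((hθ1 i).continuous_fderiv one_ne_zero).clm_apply continuous_const))
      |>.integrable_of_hasCompactSupport (((hθc i).fderiv_apply (𝕜 := ℝ) (b i)).mul_left)
  have hIBP : ∀ i, ∫ x, P x * fderiv ℝ (θ i) x (b i) = -∫ x, θ i x * fderiv ℝ P x (b i) := by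
    intro i
    have h0 := integral_fderiv_apply_eq_zero (h := fun x => P x * θ i x) (hP1.mul (hθ1 i))
      ((hθc i).mul_left) (b i)
    have hpt : ∀ x, fderiv ℝ (fun x => P x * θ i x) x (b i) =
        θ i x * fderiv ℝ P x (b i) + P x * fderiv ℝ (θ i) x (b i) := fun x => by
      rw [fderiv_fun_mul (hP1.differentiable one_ne_zero x) ((hθ1 i).differentiable one_ne_zero x)]
      simp only [_root_.add_apply, _root_.FunLike.coe_smul, Pi.smul_apply, smul_eq_mul]
      ring
    simp_rw [hpt] at h0
    have hI2 : Integrable fun x => θ i x * fderiv ℝ P x (b i) :=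
      ((hθ1 i).continuous.mul ((hP1.continuous_fderiv one_ne_zero).clm_apply continuous_const))
        |>.integrable_of_hasCompactSupport (hθc i).mul_right
    rw [integral_add hI2 (hI1 i)] at h0
    linarith
  -- step 2: the four sums
  have hS1 : ∑ i, ∫ x, (Δ (θ i)) x * ⟪U x, b i⟫ = 0 := by
    have hΔφ1 : ContDiff ℝ 1 (Δ φ) := by
      rw [show Δ φ = fun x => ∑ i, fderiv ℝ (θ i) x (b i) from funext hΔ]
      exact ContDiff.sum fun i _ => ((hθ i).fderiv_right (m := 1) le_rfl).clm_apply contDiff_const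
    have hΔφc : HasCompactSupport (Δ φ) :=
      hφc.mono' fun x hx => by
        contrapose! hx
        simp [FluidPDE.laplacian_eq_zero_of_notMem_tsupport hx]
    have h := sum_integral_fderiv_mul_inner_eq_zero b hU1 hprof.divFree hΔφ1 hΔφc
    rw [← h]
    refine Finset.sum_congr rfl fun i _ => integral_congr_ae (ae_of_all _ fun x => ?_)
    dsimp only
    rw [fderiv_laplacian_apply hφ3 x (b i)]
  have hS2 : ∑ i, ∫ x, θ i x * ⟪U x, b i⟫ = 0 :=
    sum_integral_fderiv_mul_inner_eq_zero b hU1 hprof.divFree hφ1 hφc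
  have hS3 : ∑ i, ∫ x, fderiv ℝ (θ i) x x * ⟪U x, b i⟫ = 0 := by
    -- `ξ = x·∇φ`, `∂ᵢξ = D²φ(bᵢ, x) + ∂ᵢφ`, `x·∇θᵢ = D²φ(x, bᵢ) = D²φ(bᵢ, x)`
    set ξ : ℝ³ → ℝ := fun x => fderiv ℝ φ x x with hξ_def
    have hξ1 : ContDiff ℝ 1 ξ := (hDφ2.of_le one_le_two).clm_apply contDiff_id
    have hξc : HasCompactSupport ξ :=
      (hφc.fderiv (𝕜 := ℝ)).mono fun x hx => by
        contrapose! hx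
        simp only [mem_support, not_not] at hx
        simp [hξ_def, hx]
    have hsymm : ∀ x u v, fderiv ℝ (fderiv ℝ φ) x u v = fderiv ℝ (fderiv ℝ φ) x v u := fun x u v => by
      have h22 : minSmoothness ℝ 2 ≤ (2 : ℕ∞ω) := by
        rw [minSmoothness_of_isRCLikeNormedField]
      exact (hφ2.contDiffAt.isSymmSndFDerivAt h22).eq u v
    have hpt : ∀ x i, fderiv ℝ (θ i) x x = fderiv ℝ ξ x (b i) - fderiv ℝ φ x (b i) := fun x i => by
      simp only [hθ_def, hξ_def]
      rw [fderiv_apply_const_apply (hDDφ x), fderiv_clm_apply (hDDφ x) differentiableAt_fun_id]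
      simp only [_root_.add_apply, ContinuousLinearMap.flip_apply,
        ContinuousLinearMap.coe_comp, Function.comp_apply, fderiv_fun_id, ContinuousLinearMap.coe_id',
        id_eq]
      rw [hsymm x x (b i)]
      ring
    have hIξ : ∀ i, Integrable fun x => fderiv ℝ ξ x (b i) * ⟪U x, b i⟫ := fun i =>
      (((hξ1.continuous_fderiv one_ne_zero).clm_apply continuous_const).mul
        (hU1.continuous.inner continuous_const)).integrable_of_hasCompactSupport
        ((hξc.fderiv_apply (𝕜 := ℝ) (b i)).mul_right)
    have hIφ : ∀ i, Integrable fun x => fderiv ℝ φ x (b i) * ⟪U x, b i⟫ := fun i =>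
      (((hφ1.continuous_fderiv one_ne_zero).clm_apply continuous_const).mul
        (hU1.continuous.inner continuous_const)).integrable_of_hasCompactSupport
        ((hφc.fderiv_apply (𝕜 := ℝ) (b i)).mul_right)
    have hrw : ∀ i, ∫ x, fderiv ℝ (θ i) x x * ⟪U x, b i⟫ =
        (∫ x, fderiv ℝ ξ x (b i) * ⟪U x, b i⟫) - ∫ x, fderiv ℝ φ x (b i) * ⟪U x, b i⟫ := fun i => by
      rw [← integral_sub (hIξ i) (hIφ i)]
      refine integral_congr_ae (ae_of_all _ fun x => ?_)
      dsimp only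
      rw [hpt x i]
      ring
    simp_rw [hrw]
    rw [Finset.sum_sub_distrib, sum_integral_fderiv_mul_inner_eq_zero b hU1 hprof.divFree hξ1 hξc,
      sum_integral_fderiv_mul_inner_eq_zero b hU1 hprof.divFree hφ1 hφc, sub_zero]
  have hS4 : ∑ i, ∫ x, fderiv ℝ (θ i) x (U x) * ⟪U x, b i⟫ =
      ∫ x, fderiv ℝ (fderiv ℝ φ) x (U x) (U x) := by
    have hs : ∀ i, HasCompactSupport fun x => fderiv ℝ (θ i) x (U x) := fun i =>
      ((hθc i).fderiv (𝕜 := ℝ)).mono fun x hx => by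
        contrapose! hx
        simp only [mem_support, not_not] at hx ⊢
        simp [hx]
    have hI : ∀ i, Integrable fun x => fderiv ℝ (θ i) x (U x) * ⟪U x, b i⟫ := fun i =>
      ((((hθ1 i).continuous_fderiv one_ne_zero).clm_apply hU1.continuous).mul
        (hU1.continuous.inner continuous_const)).integrable_of_hasCompactSupport (hs i).mul_right
    rw [← integral_finsetSum _ fun i _ => hI i]
    refine integral_congr_ae (ae_of_all _ fun x => ?_)
    dsimp only
    have h1 : ∀ i, fderiv ℝ (θ i) x (U x) = fderiv ℝ (fderiv ℝ φ) x (U x) (b i) := fun i =>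
      fderiv_apply_const_apply (hDDφ x) (b i) (U x)
    simp_rw [h1]
    set ℓ : ℝ³ →L[ℝ] ℝ := fderiv ℝ (fderiv ℝ φ) x (U x)
    conv_rhs => rw [← b.sum_repr' (U x)]
    rw [map_sum]
    refine Finset.sum_congr rfl fun i _ => ?_
    rw [map_smul, smul_eq_mul, real_inner_comm, mul_comm]
  -- step 3: assemble
  calc ∫ x, P x * (Δ φ) x = ∫ x, ∑ i, P x * fderiv ℝ (θ i) x (b i) :=
        integral_congr_ae (ae_of_all _ fun x => by dsimp only; rw [hΔ, Finset.mul_sum])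
    _ = ∑ i, ∫ x, P x * fderiv ℝ (θ i) x (b i) := integral_finsetSum _ fun i _ => hI1 i
    _ = ∑ i, -(ν * (∫ x, (Δ (θ i)) x * ⟪U x, b i⟫) + 2 * a * (∫ x, θ i x * ⟪U x, b i⟫) +
          a * (∫ x, fderiv ℝ (θ i) x x * ⟪U x, b i⟫) + ∫ x, fderiv ℝ (θ i) x (U x) * ⟪U x, b i⟫) :=
        Finset.sum_congr rfl fun i _ => by
          rw [hIBP i, hprof.integral_mul_fderiv_pressure (hθ i) (hθc i) (b i)]
    _ = -∫ x, fderiv ℝ (fderiv ℝ φ) x (U x) (U x) := by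
        rw [Finset.sum_neg_distrib, Finset.sum_add_distrib, Finset.sum_add_distrib,
          Finset.sum_add_distrib, ← Finset.mul_sum, ← Finset.mul_sum, ← Finset.mul_sum, hS1, hS2,
          hS3, hS4]
        ring

end ProfileCalculus

/-! ## §3. Weakly harmonic functions: mollification, the probe identity, kernel bounds -/

section Liouville

open TopologicalSpace

/-- A bound `|∫ H| ≤ M ∫_{B_ϱ} ‖F‖` for an integrand dominated by `M ‖F‖` and vanishing off the
ball `B_ϱ = {|x| ≤ ϱ}`. [folklore] -/
theorem abs_integral_le_of_bound_closedBall {G : Type*} [NormedAddCommGroup G] {H : ℝ³ → ℝ}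
    {F : ℝ³ → G} {M ϱ : ℝ} (hH : ∀ x, ‖H x‖ ≤ M * ‖F x‖) (hH0 : ∀ x, ϱ < ‖x‖ → H x = 0)
    (hF : IntegrableOn F (closedBall (0 : ℝ³) ϱ)) :
    |∫ x, H x| ≤ M * ∫ x in closedBall (0 : ℝ³) ϱ, ‖F x‖ := by
  rw [← setIntegral_eq_integral_of_forall_compl_eq_zero (s := closedBall (0 : ℝ³) ϱ)
    (fun x hx => hH0 x (by simpa using hx)), ← Real.norm_eq_abs, ← integral_const_mul]
  exact norm_integral_le_of_norm_le (hF.norm.const_mul M) (ae_of_all _ fun x => hH x)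

/-- **Mollifications of a weakly harmonic function are harmonic** (Weyl's lemma, the easy
half): if `g ∈ L¹_loc(ℝ³)` satisfies `∫ g Δφ = 0` for all `φ ∈ C_c^∞`, then `ψ ⋆ g` is a smooth
harmonic function for every test function `ψ` (`Δ(ψ ⋆ g)(x) = ∫ Δ(ψ(x − ·)) g = 0`; Tsai 1998,
p. 45: "By Weyl's lemma, `P̃` is smooth"). [cite: Tsai1998, §4 p. 45] -/
theorem harmonicOnNhd_convolution_of_forall_integral_mul_laplacian {g : ℝ³ → ℝ}
    (hg : LocallyIntegrable g volume)
    (hharm : ∀ φ : ℝ³ → ℝ, ContDiff ℝ (⊤ : ℕ∞) φ → HasCompactSupport φ → ∫ x, g x * (Δ φ) x = 0)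
    {ψ : ℝ³ → ℝ} (hψ : FunctionSpaces.IsTestFunctionOn (⊤ : Opens ℝ³) ψ) :
    HarmonicOnNhd (ψ ⋆[lsmul ℝ ℝ, volume] g) univ := by
  have hψ2 : ContDiff ℝ 2 ψ := contDiff_infty.1 hψ.contDiff 2
  have hh2 : ContDiff ℝ 2 (ψ ⋆[lsmul ℝ ℝ, volume] g) :=
    hψ.hasCompactSupport.contDiff_convolution_left _ hψ2 hg
  have hΔ : ∀ x, Δ (ψ ⋆[lsmul ℝ ℝ, volume] g) x = 0 := by
    intro x
    rw [laplacian_convolution_lsmul hψ2 hψ.hasCompactSupport hg x, convolution_def]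
    simp only [lsmul_apply, smul_eq_mul]
    have e := integral_sub_left_eq_self (fun t => (Δ ψ) t * g (x - t)) volume x
    simp only [sub_sub_cancel] at e
    rw [← e]
    have hθ := hψ.comp_sub_left x
    have key := hharm _ hθ.contDiff hθ.hasCompactSupport
    simp_rw [laplacian_comp_sub_left hψ2 x] at key
    simpa only [mul_comm] using key
  exact fun x _ => ⟨hh2.contDiffAt, Eventually.of_forall hΔ⟩

/-- **The probe identity.** For `g ∈ L¹_loc` weakly harmonic, a bump `ψ` and a probe radius
`R > 0`, the gradient of the (harmonic) mollification `η = ψ ⋆ g` is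
`∂ₑη(y) = ∫ ∂ₑΨ(y − x) g(x) dx` with `Ψ = χ_R ⋆ ψ` (mean-value formula for `∇η` against the radial
probe `χ_R`, then associativity of convolution). This is Tsai's
`D^αF(0) = (−1)^{|α|} ∫ F ε^{3+|α|}(D^αφ)(εy) dy` (p. 35) for `|α| = 1`, at an arbitrary centre and
run on the mollification. [cite: Tsai1998, Lemma 2.1 (p. 35) and §4 p. 45] -/
theorem fderiv_convolution_eq_integral_probe {g : ℝ³ → ℝ} (hg : LocallyIntegrable g volume)
    (hharm : ∀ φ : ℝ³ → ℝ, ContDiff ℝ (⊤ : ℕ∞) φ → HasCompactSupport φ → ∫ x, g x * (Δ φ) x = 0)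
    (ψ : ContDiffBump (0 : ℝ³)) {R : ℝ} (hR : 0 < R) (y e : ℝ³) :
    fderiv ℝ (ψ.normed volume ⋆[lsmul ℝ ℝ, volume] g) y e =
      ∫ x, fderiv ℝ (probeBump R ⋆[lsmul ℝ ℝ, volume] ψ.normed volume) (y - x) e * g x := by
  set ψn : ℝ³ → ℝ := ψ.normed volume with hψn_def
  have hψn : FunctionSpaces.IsTestFunctionOn (⊤ : Opens ℝ³) ψn := FunctionSpaces.isTestFunctionOn_normed ψ
  have hψnl : LocallyIntegrable ψn volume := hψn.contDiff.continuous.locallyIntegrable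
  set η : ℝ³ → ℝ := ψn ⋆[lsmul ℝ ℝ, volume] g with hη_def
  have hη : HarmonicOnNhd η univ :=
    harmonicOnNhd_convolution_of_forall_integral_mul_laplacian hg hharm hψn
  have hgn : LocallyIntegrable (fun x => ‖g x‖) volume :=
    locallyIntegrableOn_univ.1 (hg.locallyIntegrableOn univ).norm
  rw [fderiv_harmonic_eq_integral_probeBump hη hR y e]
  set χ' : ℝ³ → ℝ := fun z => fderiv ℝ (probeBump R) z e with hχ'_def
  have hχ1 : ContDiff ℝ 1 (probeBump (E := ℝ³) R) := contDiff_probeBump R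
  have hχ' : Continuous χ' := (hχ1.continuous_fderiv one_ne_zero).clm_apply continuous_const
  have hχ'c : HasCompactSupport χ' := (hasCompactSupport_probeBump hR).fderiv_apply (𝕜 := ℝ) e
  -- `∫ χ'(z) η(y - z) dz = (χ' ⋆ η)(y) = ((χ' ⋆ ψ) ⋆ g)(y)`
  have h1 : ∫ z, χ' z * η (y - z) = (χ' ⋆[lsmul ℝ ℝ, volume] η) y := by
    rw [convolution_lsmul]; rfl
  have h2 : (χ' ⋆[lsmul ℝ ℝ, volume] η) y =
      ((χ' ⋆[lsmul ℝ ℝ, volume] ψn) ⋆[lsmul ℝ ℝ, volume] g) y := by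
    refine (convolution_assoc (lsmul ℝ ℝ) (lsmul ℝ ℝ) (lsmul ℝ ℝ) (lsmul ℝ ℝ)
      (fun x y z => by simp [mul_assoc]) hχ'.aestronglyMeasurable
      hψn.contDiff.continuous.aestronglyMeasurable hg.aestronglyMeasurable
      (Eventually.of_forall (hχ'c.convolutionExists_left _ hχ' hψnl))
      (Eventually.of_forall (hψn.hasCompactSupport.norm.convolutionExists_left (mul ℝ ℝ)
        hψn.contDiff.continuous.norm hgn)) ?_).symm
    refine hχ'c.norm.convolutionExists_left (mul ℝ ℝ) hχ'.norm ?_ y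
    exact (hψn.hasCompactSupport.norm.continuous_convolution_left (mul ℝ ℝ)
      hψn.contDiff.continuous.norm hgn).locallyIntegrable
  -- `χ' ⋆ ψ = ∂ₑ(χ_R ⋆ ψ)`
  have h3 : χ' ⋆[lsmul ℝ ℝ, volume] ψn =
      fun s => fderiv ℝ (probeBump R ⋆[lsmul ℝ ℝ, volume] ψn) s e :=
    funext fun s => (fderiv_convolution_lsmul_apply hχ1 (hasCompactSupport_probeBump hR) hψnl s e).symm
  rw [h1, h2, h3, convolution_lsmul]
  have e4 := integral_sub_left_eq_self
    (fun x => fderiv ℝ (probeBump R ⋆[lsmul ℝ ℝ, volume] ψn) (y - x) e * g x) volume y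
  simp only [sub_sub_cancel] at e4
  simpa only [smul_eq_mul] using e4

/-- The regularised probe `Ψ = χ_R ⋆ ψ` is supported in the ball of radius `2R + r_ψ`. [folklore] -/
theorem tsupport_probeBump_convolution_subset (ψ : ContDiffBump (0 : ℝ³)) {R : ℝ} (hR : 0 < R) :
    tsupport (probeBump R ⋆[lsmul ℝ ℝ, volume] ψ.normed volume) ⊆
      closedBall (0 : ℝ³) (2 * R + ψ.rOut) := by
  refine closure_minimal ?_ isClosed_closedBall
  intro z hz
  obtain ⟨u, hu, v, hv, rfl⟩ := support_convolution_subset _ hz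
  have hu' : ‖u‖ ≤ 2 * R := mem_closedBall_zero_iff.1 (tsupport_probeBump_subset hR (subset_tsupport _ hu))
  have hv' : ‖v‖ < ψ.rOut := by
    rw [ψ.support_normed_eq] at hv
    exact mem_ball_zero_iff.1 hv
  exact mem_closedBall_zero_iff.2 ((norm_add_le u v).trans (by linarith))

/-- Off the ball of radius `‖y‖ + 2R + r_ψ` the reflected translate `Ψ(y − ·)` of the regularised
probe vanishes identically near the point. [folklore] -/
theorem sub_notMem_tsupport_probeBump_convolution (ψ : ContDiffBump (0 : ℝ³)) {R : ℝ} (hR : 0 < R)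
    (y : ℝ³) {x : ℝ³} (hx : ‖y‖ + (2 * R + ψ.rOut) < ‖x‖) :
    y - x ∉ tsupport (probeBump R ⋆[lsmul ℝ ℝ, volume] ψ.normed volume) := by
  intro h
  have h1 := mem_closedBall_zero_iff.1 (tsupport_probeBump_convolution_subset ψ hR h)
  have h2 : ‖x‖ - ‖y‖ ≤ ‖y - x‖ := by
    rw [← norm_neg (y - x), neg_sub]; exact norm_sub_norm_le x y
  linarith

/-- **Convolution with a probability kernel does not increase the sup norm**:
`|(f ⋆ ψ)(s)| ≤ M` when `|f| ≤ M`, for the normalised bump `ψ`. [folklore] -/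
theorem abs_convolution_normed_le {f : ℝ³ → ℝ} {M : ℝ} (hf : ∀ t, |f t| ≤ M)
    (ψ : ContDiffBump (0 : ℝ³)) (s : ℝ³) :
    |(f ⋆[lsmul ℝ ℝ, volume] ψ.normed volume) s| ≤ M := by
  rw [convolution_lsmul]
  simp only [smul_eq_mul]
  have hb : ∀ t, ‖f t * ψ.normed volume (s - t)‖ ≤ M * ψ.normed volume (s - t) := fun t => by
    rw [norm_mul, Real.norm_eq_abs, Real.norm_eq_abs, abs_of_nonneg (ψ.nonneg_normed _)]
    exact mul_le_mul_of_nonneg_right (hf t) (ψ.nonneg_normed _)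
  have hi : Integrable fun t => M * ψ.normed volume (s - t) :=
    (ψ.integrable_normed.comp_sub_left s).const_mul M
  rw [← Real.norm_eq_abs]
  refine (norm_integral_le_of_norm_le hi (ae_of_all _ hb)).trans_eq ?_
  rw [integral_const_mul, integral_sub_left_eq_self (ψ.normed volume) volume s, ψ.integral_normed,
    mul_one]

/-- The scaling bookkeeping of the Liouville step: for `R ≥ 1`, `0 ≤ ϱ ≤ Λ R`, `s ≥ 0` and a
natural number `n` with `s − n ≤ −2/5`, `R⁻ⁿ ϱ^s ≤ Λ^s R^{−2/5}` (Tsai 1998, p. 45: the net power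
`ε^{3+|α|} ε^{−13/5}` of the scaling parameter is positive). [cite: Tsai1998, §4 p. 45] -/
theorem inv_pow_mul_rpow_le {R Λ ϱ s : ℝ} {n : ℕ} (hR : 1 ≤ R) (hΛ : 0 ≤ Λ) (hϱ : 0 ≤ ϱ)
    (hϱΛ : ϱ ≤ Λ * R) (hs : 0 ≤ s) (hsn : s - n ≤ -(2 / 5)) :
    (R ^ n)⁻¹ * ϱ ^ s ≤ Λ ^ s * R ^ (-(2 / 5) : ℝ) := by
  have hR0 : 0 < R := one_pos.trans_le hR
  have h1 : ϱ ^ s ≤ Λ ^ s * R ^ s := by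
    rw [← Real.mul_rpow hΛ hR0.le]
    exact Real.rpow_le_rpow hϱ hϱΛ hs
  have h2 : (R ^ n)⁻¹ * R ^ s = R ^ (s - n) := by
    rw [Real.rpow_sub hR0, Real.rpow_natCast, div_eq_inv_mul]
  calc (R ^ n)⁻¹ * ϱ ^ s ≤ (R ^ n)⁻¹ * (Λ ^ s * R ^ s) :=
        mul_le_mul_of_nonneg_left h1 (by positivity)
    _ = Λ ^ s * ((R ^ n)⁻¹ * R ^ s) := by ring
    _ ≤ Λ ^ s * R ^ (-(2 / 5) : ℝ) := by
        rw [h2]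
        exact mul_le_mul_of_nonneg_left (Real.rpow_le_rpow_of_exponent_le hR hsn) (by positivity)

end Liouville

/-! ## §4. The Liouville step: mollifications of `P − P̃` have zero gradient -/

section MainEstimate

open TopologicalSpace

variable {ν a : ℝ} {U : ℝ³ → ℝ³} {P : ℝ³ → ℝ}

/-- **The fixed-scale estimate** behind the Liouville step (Tsai 1998, p. 45, the displayed
chain of inequalities, with `ε = R⁻¹` and `|α| = 1`). Let `(U, P)` be a Leray profile, `Q` a
locally integrable function with `P − Q` weakly harmonic, and suppose the ball bounds
`∫_{B_ϱ} |U| ≤ A_U ϱ^{13/5}`, `∫_{B_ϱ} |U|² ≤ A_{U²} ϱ^{11/5}`, `∫_{B_ϱ} |Q| ≤ A_Q ϱ^{11/5}` (the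
weighted Hölder inequality). Then for every bump `ψ`, centre `y`, direction `e` and probe radius
`R ≥ 1`, the mollification `η = ψ ⋆ (P − Q)` satisfies `|∂ₑη(y)| ≤ K R^{-2/5}` with `K`
independent of `R` (explicit below; `m`, `C₁`, `C₂` are the mass and derivative bounds of the
base bump of the probes `χ_R`). [cite: Tsai1998, Lemma 2.1 (pp. 35–36) and §4 p. 45] -/
theorem IsLerayProfile.abs_fderiv_normed_convolution_sub_le (hprof : IsLerayProfile ν a U P)
    {Q : ℝ³ → ℝ} (hQl : LocallyIntegrable Q volume)
    (hharm : ∀ φ : ℝ³ → ℝ, ContDiff ℝ (⊤ : ℕ∞) φ → HasCompactSupport φ →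
      ∫ x, (P x - Q x) * (Δ φ) x = 0)
    {AU AU2 AQ : ℝ} (hAU0 : 0 ≤ AU) (hAU20 : 0 ≤ AU2) (hAQ0 : 0 ≤ AQ)
    (hballU : ∀ ϱ : ℝ, 0 < ϱ → IntegrableOn U (closedBall (0 : ℝ³) ϱ) ∧
      ∫ x in closedBall (0 : ℝ³) ϱ, ‖U x‖ ≤ AU * ϱ ^ (13 / 5 : ℝ))
    (hballU2 : ∀ ϱ : ℝ, 0 < ϱ → IntegrableOn (fun x => ‖U x‖ ^ 2) (closedBall (0 : ℝ³) ϱ) ∧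
      ∫ x in closedBall (0 : ℝ³) ϱ, ‖(‖U x‖ ^ 2)‖ ≤ AU2 * ϱ ^ (11 / 5 : ℝ))
    (hballQ : ∀ ϱ : ℝ, 0 < ϱ → IntegrableOn Q (closedBall (0 : ℝ³) ϱ) ∧
      ∫ x in closedBall (0 : ℝ³) ϱ, ‖Q x‖ ≤ AQ * ϱ ^ (11 / 5 : ℝ))
    {C₁ C₂ : ℝ} (hC₁ : ∀ x : ℝ³, ‖fderiv ℝ baseBump x‖ ≤ C₁)
    (hC₂ : ∀ x : ℝ³, |(Δ (baseBump : ℝ³ → ℝ)) x| ≤ C₂) (hC₁0 : 0 ≤ C₁) (hC₂0 : 0 ≤ C₂)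
    (ψ : ContDiffBump (0 : ℝ³)) (y e : ℝ³) {R : ℝ} (hR : 1 ≤ R) :
    |fderiv ℝ (ψ.normed volume ⋆[lsmul ℝ ℝ, volume] fun x => P x - Q x) y e| ≤
      ‖e‖ * (baseBumpMass ℝ³)⁻¹ *
        (|ν| * C₂ * AU * (‖y‖ + 2 + ψ.rOut) ^ (13 / 5 : ℝ) +
          2 * |a| * AU * (‖y‖ + 2 + ψ.rOut) ^ (13 / 5 : ℝ) +
          |a| * C₁ * AU * (‖y‖ + 2 + ψ.rOut) ^ (18 / 5 : ℝ) +
          C₁ * (AU2 + AQ) * (‖y‖ + 2 + ψ.rOut) ^ (11 / 5 : ℝ)) * R ^ (-(2 / 5) : ℝ) := by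
  have hU2 := hprof.contDiff_velocity
  have hU1 : ContDiff ℝ 1 U := hU2.of_le one_le_two
  have hP1 := hprof.contDiff_pressure
  have hgl : LocallyIntegrable (fun x => P x - Q x) volume := hP1.continuous.locallyIntegrable.sub hQl
  have hm : 0 < baseBumpMass ℝ³ := baseBumpMass_pos
  set m : ℝ := baseBumpMass ℝ³ with hm_def
  have hd : Module.finrank ℝ ℝ³ = 3 := finrank_euclideanSpace_fin
  have hr : 0 < ψ.rOut := ψ.rOut_pos
  set Λ : ℝ := ‖y‖ + 2 + ψ.rOut with hΛ_def
  have hΛ0 : 0 ≤ Λ := by positivity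
  have hR0 : 0 < R := one_pos.trans_le hR
  -- the probe identity (before naming `Ψ`, so that `set` folds it)
  have hprobe := fderiv_convolution_eq_integral_probe hgl hharm ψ hR0 y e
  have hψn : FunctionSpaces.IsTestFunctionOn (⊤ : Opens ℝ³) (ψ.normed volume) :=
    FunctionSpaces.isTestFunctionOn_normed ψ
  have hψnl : LocallyIntegrable (ψ.normed volume) volume := hψn.contDiff.continuous.locallyIntegrable
  have hDconv : ∀ s v, fderiv ℝ (probeBump R ⋆[lsmul ℝ ℝ, volume] ψ.normed volume) s v =
      ((fun t => fderiv ℝ (probeBump R) t v) ⋆[lsmul ℝ ℝ, volume] ψ.normed volume) s := fun s v =>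
    fderiv_convolution_lsmul_apply (contDiff_probeBump R) (hasCompactSupport_probeBump hR0) hψnl s v
  have hΔconv : ∀ s, (Δ (probeBump R ⋆[lsmul ℝ ℝ, volume] ψ.normed volume)) s =
      ((Δ (probeBump R : ℝ³ → ℝ)) ⋆[lsmul ℝ ℝ, volume] ψ.normed volume) s := fun s =>
    laplacian_convolution_lsmul (contDiff_probeBump R) (hasCompactSupport_probeBump hR0) hψnl s
  have hΨ' : ContDiff ℝ (⊤ : ℕ∞) (probeBump R ⋆[lsmul ℝ ℝ, volume] ψ.normed volume) :=
    (hasCompactSupport_probeBump hR0).contDiff_convolution_left _ (contDiff_probeBump R) hψnl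
  have hΨc' : HasCompactSupport (probeBump R ⋆[lsmul ℝ ℝ, volume] ψ.normed volume) :=
    (hasCompactSupport_probeBump hR0).convolution _ ψ.hasCompactSupport_normed
  have hout' : ∀ x : ℝ³, ‖y‖ + (2 * R + ψ.rOut) < ‖x‖ →
      y - x ∉ tsupport (probeBump R ⋆[lsmul ℝ ℝ, volume] ψ.normed volume) := fun x hx =>
    sub_notMem_tsupport_probeBump_convolution ψ hR0 y hx
  set Ψ : ℝ³ → ℝ := probeBump R ⋆[lsmul ℝ ℝ, volume] ψ.normed volume with hΨ_def
  -- sup bounds `|Ψ| ≤ M₀`, `|DΨ v| ≤ M₁ |v|`, `|ΔΨ| ≤ M₂`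
  have hM₀ : ∀ s, |Ψ s| ≤ (m * R ^ 3)⁻¹ := fun s =>
    abs_convolution_normed_le (fun t => by
      have h := abs_probeBump_le hR0 t
      rwa [hd] at h) ψ s
  have hM₁ : ∀ s v, |fderiv ℝ Ψ s v| ≤ (m * R ^ 3)⁻¹ * R⁻¹ * C₁ * ‖v‖ := fun s v => by
    rw [hDconv s v]
    refine abs_convolution_normed_le (fun t => ?_) ψ s
    have h := norm_fderiv_probeBump_le hR0 hC₁ t
    rw [hd] at h
    calc |fderiv ℝ (probeBump R) t v| ≤ ‖fderiv ℝ (probeBump R) t‖ * ‖v‖ := by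
          rw [← Real.norm_eq_abs]; exact le_opNorm _ _
      _ ≤ (m * R ^ 3)⁻¹ * R⁻¹ * C₁ * ‖v‖ := mul_le_mul_of_nonneg_right h (norm_nonneg _)
  have hM₂ : ∀ s, |(Δ Ψ) s| ≤ (m * R ^ 3)⁻¹ * R⁻¹ ^ 2 * C₂ := fun s => by
    rw [hΔconv s]
    refine abs_convolution_normed_le (fun t => ?_) ψ s
    have h := abs_laplacian_probeBump_le hR0 hC₂ t
    rwa [hd] at h
  set M₀ : ℝ := (m * R ^ 3)⁻¹ with hM₀_def
  set M₁ : ℝ := (m * R ^ 3)⁻¹ * R⁻¹ * C₁ with hM₁_def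
  set M₂ : ℝ := (m * R ^ 3)⁻¹ * R⁻¹ ^ 2 * C₂ with hM₂_def
  have hM₀0 : 0 ≤ M₀ := by rw [hM₀_def]; positivity
  have hM₁0 : 0 ≤ M₁ := by rw [hM₁_def]; positivity
  have hM₂0 : 0 ≤ M₂ := by rw [hM₂_def]; positivity
  have hΨ : ContDiff ℝ (⊤ : ℕ∞) Ψ := hΨ'
  have hΨ2 : ContDiff ℝ 2 Ψ := contDiff_infty.1 hΨ 2
  have hΨ1 : ContDiff ℝ 1 Ψ := contDiff_infty.1 hΨ 1
  have hΨc : HasCompactSupport Ψ := hΨc'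
  clear_value M₀ M₁ M₂ Ψ
  -- the split into the `P`- and `Q`-parts
  have hDΨc : HasCompactSupport fun x => fderiv ℝ Ψ (y - x) e :=
    (hΨc.fderiv_apply (𝕜 := ℝ) e).comp_homeomorph (Homeomorph.subLeft y)
  have hDΨcont : Continuous fun x => fderiv ℝ Ψ (y - x) e :=
    ((hΨ1.continuous_fderiv one_ne_zero).clm_apply continuous_const).comp
      (continuous_const.sub continuous_id)
  have iP : Integrable fun x => fderiv ℝ Ψ (y - x) e * P x :=
    (hDΨcont.mul hP1.continuous).integrable_of_hasCompactSupport hDΨc.mul_right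
  have iQ : Integrable fun x => fderiv ℝ Ψ (y - x) e * Q x := by
    simpa only [smul_eq_mul] using hQl.integrable_smul_left_of_hasCompactSupport hDΨcont hDΨc
  have hsplit : fderiv ℝ (ψ.normed volume ⋆[lsmul ℝ ℝ, volume] fun x => P x - Q x) y e =
      (∫ x, fderiv ℝ Ψ (y - x) e * P x) - ∫ x, fderiv ℝ Ψ (y - x) e * Q x := by
    rw [hprobe, ← integral_sub iP iQ]
    refine integral_congr_ae (ae_of_all _ fun x => ?_)
    ring
  -- the `P`-part: move the derivative to `P`, then use the profile equation
  set θ : ℝ³ → ℝ := fun x => Ψ (y - x) with hθ_def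
  have hΨT : FunctionSpaces.IsTestFunctionOn (⊤ : Opens ℝ³) Ψ := ⟨hΨ, hΨc, by simp⟩
  have hθT : FunctionSpaces.IsTestFunctionOn (⊤ : Opens ℝ³) θ := hΨT.comp_sub_left y
  have hθ2 : ContDiff ℝ 2 θ := contDiff_infty.1 hθT.contDiff 2
  have hP_part : ∫ x, fderiv ℝ Ψ (y - x) e * P x =
      ν * (∫ x, (Δ θ) x * ⟪U x, e⟫) + 2 * a * (∫ x, θ x * ⟪U x, e⟫) +
        a * (∫ x, fderiv ℝ θ x x * ⟪U x, e⟫) + ∫ x, fderiv ℝ θ x (U x) * ⟪U x, e⟫ := by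
    rw [← hprof.integral_mul_fderiv_pressure hθ2 hθT.hasCompactSupport e]
    have h := integral_fderiv_mul_comp_sub hΨ1 hΨc hP1 y e
    have e1 := integral_sub_left_eq_self (fun x => fderiv ℝ Ψ (y - x) e * P x) volume y
    have e2 := integral_sub_left_eq_self (fun x => Ψ (y - x) * fderiv ℝ P x e) volume y
    simp only [sub_sub_cancel] at e1 e2
    rw [← e1, h, e2]
  -- vanishing outside the ball of radius `ϱ`
  set ϱ : ℝ := ‖y‖ + (2 * R + ψ.rOut) with hϱ_def
  have hϱ0 : 0 < ϱ := by positivity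
  have hϱΛ : ϱ ≤ Λ * R := by
    have h1 : ‖y‖ ≤ ‖y‖ * R := le_mul_of_one_le_right (norm_nonneg _) hR
    have h2 : ψ.rOut ≤ ψ.rOut * R := le_mul_of_one_le_right hr.le hR
    rw [hϱ_def, hΛ_def]
    linarith
  have hout : ∀ x, ϱ < ‖x‖ →
      θ x = 0 ∧ fderiv ℝ θ x = 0 ∧ (Δ θ) x = 0 ∧ fderiv ℝ Ψ (y - x) = 0 := by
    intro x hx
    have hn := hout' x hx
    have h1 : fderiv ℝ Ψ (y - x) = 0 := fderiv_of_notMem_tsupport ℝ hn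
    refine ⟨?_, ?_, ?_, h1⟩
    · show Ψ (y - x) = 0
      exact image_eq_zero_of_notMem_tsupport hn
    · ext v
      rw [hθ_def, FunctionSpaces.fderiv_comp_sub_left_apply hΨ1 y x v, h1]
      simp
    · rw [hθ_def, laplacian_comp_sub_left hΨ2 y x]
      exact FluidPDE.laplacian_eq_zero_of_notMem_tsupport hn
  -- the five bounds
  obtain ⟨hUint, hU13⟩ := hballU ϱ hϱ0
  obtain ⟨hU2int, hU11⟩ := hballU2 ϱ hϱ0
  obtain ⟨hQint, hQ11⟩ := hballQ ϱ hϱ0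
  set I₁ := ∫ x in closedBall (0 : ℝ³) ϱ, ‖U x‖ with hI₁
  set I₂ := ∫ x in closedBall (0 : ℝ³) ϱ, ‖(‖U x‖ ^ 2)‖ with hI₂
  set I₃ := ∫ x in closedBall (0 : ℝ³) ϱ, ‖Q x‖ with hI₃
  have hT1 : |∫ x, (Δ θ) x * ⟪U x, e⟫| ≤ M₂ * ‖e‖ * I₁ := by
    refine abs_integral_le_of_bound_closedBall (fun x => ?_) (fun x hx => ?_) hUint
    · rw [norm_mul, Real.norm_eq_abs, Real.norm_eq_abs]
      calc |(Δ θ) x| * |⟪U x, e⟫| ≤ M₂ * (‖U x‖ * ‖e‖) :=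
            mul_le_mul (by rw [hθ_def, laplacian_comp_sub_left hΨ2 y x]; exact hM₂ _)
              (abs_real_inner_le_norm _ _) (abs_nonneg _) hM₂0
        _ = M₂ * ‖e‖ * ‖U x‖ := by ring
    · rw [(hout x hx).2.2.1, zero_mul]
  have hT2 : |∫ x, θ x * ⟪U x, e⟫| ≤ M₀ * ‖e‖ * I₁ := by
    refine abs_integral_le_of_bound_closedBall (fun x => ?_) (fun x hx => ?_) hUint
    · rw [norm_mul, Real.norm_eq_abs, Real.norm_eq_abs]
      calc |θ x| * |⟪U x, e⟫| ≤ M₀ * (‖U x‖ * ‖e‖) :=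
            mul_le_mul (hM₀ _) (abs_real_inner_le_norm _ _) (abs_nonneg _) hM₀0
        _ = M₀ * ‖e‖ * ‖U x‖ := by ring
    · rw [(hout x hx).1, zero_mul]
  have hT3 : |∫ x, fderiv ℝ θ x x * ⟪U x, e⟫| ≤ M₁ * ϱ * ‖e‖ * I₁ := by
    refine abs_integral_le_of_bound_closedBall (fun x => ?_) (fun x hx => ?_) hUint
    · rw [norm_mul, Real.norm_eq_abs, Real.norm_eq_abs]
      have hDθ : |fderiv ℝ θ x x| ≤ M₁ * ϱ := by
        by_cases hx : ‖x‖ ≤ ϱ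
        · rw [hθ_def, FunctionSpaces.fderiv_comp_sub_left_apply hΨ1 y x x, abs_neg]
          exact (hM₁ _ _).trans (mul_le_mul_of_nonneg_left hx hM₁0)
        · rw [(hout x (not_le.1 hx)).2.1]
          simp only [_root_.zero_apply, abs_zero]
          positivity
      calc |fderiv ℝ θ x x| * |⟪U x, e⟫| ≤ M₁ * ϱ * (‖U x‖ * ‖e‖) :=
            mul_le_mul hDθ (abs_real_inner_le_norm _ _) (abs_nonneg _) (by positivity)
        _ = M₁ * ϱ * ‖e‖ * ‖U x‖ := by ring
    · rw [(hout x hx).2.1, _root_.zero_apply, zero_mul]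
  have hT4 : |∫ x, fderiv ℝ θ x (U x) * ⟪U x, e⟫| ≤ M₁ * ‖e‖ * I₂ := by
    refine abs_integral_le_of_bound_closedBall (fun x => ?_) (fun x hx => ?_) hU2int
    · rw [norm_mul, Real.norm_eq_abs, Real.norm_eq_abs, Real.norm_of_nonneg (sq_nonneg _)]
      have hDθ : |fderiv ℝ θ x (U x)| ≤ M₁ * ‖U x‖ := by
        rw [hθ_def, FunctionSpaces.fderiv_comp_sub_left_apply hΨ1 y x (U x), abs_neg]
        exact hM₁ _ _
      calc |fderiv ℝ θ x (U x)| * |⟪U x, e⟫| ≤ M₁ * ‖U x‖ * (‖U x‖ * ‖e‖) :=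
            mul_le_mul hDθ (abs_real_inner_le_norm _ _) (abs_nonneg _) (by positivity)
        _ = M₁ * ‖e‖ * ‖U x‖ ^ 2 := by ring
    · rw [(hout x hx).2.1, _root_.zero_apply, zero_mul]
  have hT5 : |∫ x, fderiv ℝ Ψ (y - x) e * Q x| ≤ M₁ * ‖e‖ * I₃ := by
    refine abs_integral_le_of_bound_closedBall (fun x => ?_) (fun x hx => ?_) hQint
    · rw [norm_mul, Real.norm_eq_abs]
      exact mul_le_mul_of_nonneg_right (hM₁ _ _) (norm_nonneg _)
    · rw [(hout x hx).2.2.2, _root_.zero_apply, zero_mul]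
  clear_value I₁ I₂ I₃
  -- scaling: every term is `O(R^{-2/5})`
  have hmR : (m * R ^ 3)⁻¹ = m⁻¹ * (R ^ 3)⁻¹ := mul_inv _ _
  have hR3 : (R ^ 3)⁻¹ * R⁻¹ = (R ^ 4)⁻¹ := by
    rw [← mul_inv, ← pow_succ]
  have hR5 : (R ^ 3)⁻¹ * R⁻¹ ^ 2 = (R ^ 5)⁻¹ := by
    rw [inv_pow, ← mul_inv, ← pow_add]
  have b0 : M₀ * ϱ ^ (13 / 5 : ℝ) ≤ m⁻¹ * (Λ ^ (13 / 5 : ℝ) * R ^ (-(2 / 5) : ℝ)) := by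
    have h := inv_pow_mul_rpow_le (n := 3) (s := 13 / 5) hR hΛ0 hϱ0.le hϱΛ (by norm_num)
      (by norm_num)
    calc M₀ * ϱ ^ (13 / 5 : ℝ) = m⁻¹ * ((R ^ 3)⁻¹ * ϱ ^ (13 / 5 : ℝ)) := by
          rw [hM₀_def, hmR, mul_assoc]
      _ ≤ m⁻¹ * (Λ ^ (13 / 5 : ℝ) * R ^ (-(2 / 5) : ℝ)) :=
          mul_le_mul_of_nonneg_left h (inv_nonneg.2 hm.le)
  have b2 : M₂ * ϱ ^ (13 / 5 : ℝ) ≤ m⁻¹ * C₂ * (Λ ^ (13 / 5 : ℝ) * R ^ (-(2 / 5) : ℝ)) := by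
    have h := inv_pow_mul_rpow_le (n := 5) (s := 13 / 5) hR hΛ0 hϱ0.le hϱΛ (by norm_num)
      (by norm_num)
    calc M₂ * ϱ ^ (13 / 5 : ℝ) = m⁻¹ * C₂ * ((R ^ 5)⁻¹ * ϱ ^ (13 / 5 : ℝ)) := by
          rw [hM₂_def, hmR, mul_assoc m⁻¹, hR5]; ring
      _ ≤ m⁻¹ * C₂ * (Λ ^ (13 / 5 : ℝ) * R ^ (-(2 / 5) : ℝ)) :=
          mul_le_mul_of_nonneg_left h (by positivity)
  have b1 : M₁ * ϱ * ϱ ^ (13 / 5 : ℝ) ≤ m⁻¹ * C₁ * (Λ ^ (18 / 5 : ℝ) * R ^ (-(2 / 5) : ℝ)) := by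
    have h := inv_pow_mul_rpow_le (n := 4) (s := 18 / 5) hR hΛ0 hϱ0.le hϱΛ (by norm_num)
      (by norm_num)
    have hϱpow : ϱ * ϱ ^ (13 / 5 : ℝ) = ϱ ^ (18 / 5 : ℝ) := by
      rw [show (18 / 5 : ℝ) = 1 + 13 / 5 by norm_num, Real.rpow_add hϱ0, Real.rpow_one]
    calc M₁ * ϱ * ϱ ^ (13 / 5 : ℝ) = m⁻¹ * C₁ * ((R ^ 4)⁻¹ * ϱ ^ (18 / 5 : ℝ)) := by
          rw [mul_assoc, hϱpow, hM₁_def, hmR, mul_assoc m⁻¹, hR3]; ring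
      _ ≤ m⁻¹ * C₁ * (Λ ^ (18 / 5 : ℝ) * R ^ (-(2 / 5) : ℝ)) :=
          mul_le_mul_of_nonneg_left h (by positivity)
  have b1' : M₁ * ϱ ^ (11 / 5 : ℝ) ≤ m⁻¹ * C₁ * (Λ ^ (11 / 5 : ℝ) * R ^ (-(2 / 5) : ℝ)) := by
    have h := inv_pow_mul_rpow_le (n := 4) (s := 11 / 5) hR hΛ0 hϱ0.le hϱΛ (by norm_num)
      (by norm_num)
    calc M₁ * ϱ ^ (11 / 5 : ℝ) = m⁻¹ * C₁ * ((R ^ 4)⁻¹ * ϱ ^ (11 / 5 : ℝ)) := by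
          rw [hM₁_def, hmR, mul_assoc m⁻¹, hR3]; ring
      _ ≤ m⁻¹ * C₁ * (Λ ^ (11 / 5 : ℝ) * R ^ (-(2 / 5) : ℝ)) :=
          mul_le_mul_of_nonneg_left h (by positivity)
  -- assemble
  have hI₁ : I₁ ≤ AU * ϱ ^ (13 / 5 : ℝ) := hU13
  have hI₂ : I₂ ≤ AU2 * ϱ ^ (11 / 5 : ℝ) := hU11
  have hI₃ : I₃ ≤ AQ * ϱ ^ (11 / 5 : ℝ) := hQ11
  have he : 0 ≤ ‖e‖ := norm_nonneg e
  have t1 : |ν| * |∫ x, (Δ θ) x * ⟪U x, e⟫| ≤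
      |ν| * ‖e‖ * AU * (m⁻¹ * C₂ * (Λ ^ (13 / 5 : ℝ) * R ^ (-(2 / 5) : ℝ))) :=
    calc |ν| * |∫ x, (Δ θ) x * ⟪U x, e⟫| ≤ |ν| * (M₂ * ‖e‖ * (AU * ϱ ^ (13 / 5 : ℝ))) :=
          mul_le_mul_of_nonneg_left
            (hT1.trans (mul_le_mul_of_nonneg_left hI₁ (mul_nonneg hM₂0 he))) (abs_nonneg _)
      _ = |ν| * ‖e‖ * AU * (M₂ * ϱ ^ (13 / 5 : ℝ)) := by ring
      _ ≤ |ν| * ‖e‖ * AU * (m⁻¹ * C₂ * (Λ ^ (13 / 5 : ℝ) * R ^ (-(2 / 5) : ℝ))) :=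
          mul_le_mul_of_nonneg_left b2 (by positivity)
  have t2 : 2 * |a| * |∫ x, θ x * ⟪U x, e⟫| ≤
      2 * |a| * ‖e‖ * AU * (m⁻¹ * (Λ ^ (13 / 5 : ℝ) * R ^ (-(2 / 5) : ℝ))) :=
    calc 2 * |a| * |∫ x, θ x * ⟪U x, e⟫| ≤ 2 * |a| * (M₀ * ‖e‖ * (AU * ϱ ^ (13 / 5 : ℝ))) :=
          mul_le_mul_of_nonneg_left
            (hT2.trans (mul_le_mul_of_nonneg_left hI₁ (mul_nonneg hM₀0 he))) (by positivity)
      _ = 2 * |a| * ‖e‖ * AU * (M₀ * ϱ ^ (13 / 5 : ℝ)) := by ring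
      _ ≤ 2 * |a| * ‖e‖ * AU * (m⁻¹ * (Λ ^ (13 / 5 : ℝ) * R ^ (-(2 / 5) : ℝ))) :=
          mul_le_mul_of_nonneg_left b0 (by positivity)
  have t3 : |a| * |∫ x, fderiv ℝ θ x x * ⟪U x, e⟫| ≤
      |a| * ‖e‖ * AU * (m⁻¹ * C₁ * (Λ ^ (18 / 5 : ℝ) * R ^ (-(2 / 5) : ℝ))) :=
    calc |a| * |∫ x, fderiv ℝ θ x x * ⟪U x, e⟫| ≤
        |a| * (M₁ * ϱ * ‖e‖ * (AU * ϱ ^ (13 / 5 : ℝ))) :=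
          mul_le_mul_of_nonneg_left
            (hT3.trans (mul_le_mul_of_nonneg_left hI₁ (by positivity))) (abs_nonneg _)
      _ = |a| * ‖e‖ * AU * (M₁ * ϱ * ϱ ^ (13 / 5 : ℝ)) := by ring
      _ ≤ |a| * ‖e‖ * AU * (m⁻¹ * C₁ * (Λ ^ (18 / 5 : ℝ) * R ^ (-(2 / 5) : ℝ))) :=
          mul_le_mul_of_nonneg_left b1 (by positivity)
  have t4 : |∫ x, fderiv ℝ θ x (U x) * ⟪U x, e⟫| ≤
      ‖e‖ * AU2 * (m⁻¹ * C₁ * (Λ ^ (11 / 5 : ℝ) * R ^ (-(2 / 5) : ℝ))) :=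
    calc |∫ x, fderiv ℝ θ x (U x) * ⟪U x, e⟫| ≤ M₁ * ‖e‖ * (AU2 * ϱ ^ (11 / 5 : ℝ)) :=
          hT4.trans (mul_le_mul_of_nonneg_left hI₂ (mul_nonneg hM₁0 he))
      _ = ‖e‖ * AU2 * (M₁ * ϱ ^ (11 / 5 : ℝ)) := by ring
      _ ≤ ‖e‖ * AU2 * (m⁻¹ * C₁ * (Λ ^ (11 / 5 : ℝ) * R ^ (-(2 / 5) : ℝ))) :=
          mul_le_mul_of_nonneg_left b1' (by positivity)
  have t5 : |∫ x, fderiv ℝ Ψ (y - x) e * Q x| ≤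
      ‖e‖ * AQ * (m⁻¹ * C₁ * (Λ ^ (11 / 5 : ℝ) * R ^ (-(2 / 5) : ℝ))) :=
    calc |∫ x, fderiv ℝ Ψ (y - x) e * Q x| ≤ M₁ * ‖e‖ * (AQ * ϱ ^ (11 / 5 : ℝ)) :=
          hT5.trans (mul_le_mul_of_nonneg_left hI₃ (mul_nonneg hM₁0 he))
      _ = ‖e‖ * AQ * (M₁ * ϱ ^ (11 / 5 : ℝ)) := by ring
      _ ≤ ‖e‖ * AQ * (m⁻¹ * C₁ * (Λ ^ (11 / 5 : ℝ) * R ^ (-(2 / 5) : ℝ))) :=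
          mul_le_mul_of_nonneg_left b1' (by positivity)
  have htri : |ν * (∫ x, (Δ θ) x * ⟪U x, e⟫) + 2 * a * (∫ x, θ x * ⟪U x, e⟫) +
        a * (∫ x, fderiv ℝ θ x x * ⟪U x, e⟫) + (∫ x, fderiv ℝ θ x (U x) * ⟪U x, e⟫) -
        ∫ x, fderiv ℝ Ψ (y - x) e * Q x| ≤
      |ν| * |∫ x, (Δ θ) x * ⟪U x, e⟫| + 2 * |a| * |∫ x, θ x * ⟪U x, e⟫| +
        |a| * |∫ x, fderiv ℝ θ x x * ⟪U x, e⟫| + |∫ x, fderiv ℝ θ x (U x) * ⟪U x, e⟫| +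
        |∫ x, fderiv ℝ Ψ (y - x) e * Q x| := by
    refine (abs_sub _ _).trans (add_le_add ?_ le_rfl)
    refine (abs_add_le _ _).trans (add_le_add ?_ le_rfl)
    refine (abs_add_le _ _).trans (add_le_add ((abs_add_le _ _).trans (add_le_add ?_ ?_)) ?_)
    · rw [abs_mul]
    · rw [abs_mul, abs_mul, abs_two]
    · rw [abs_mul]
  have hKR : ‖e‖ * m⁻¹ * (|ν| * C₂ * AU * Λ ^ (13 / 5 : ℝ) + 2 * |a| * AU * Λ ^ (13 / 5 : ℝ) +
        |a| * C₁ * AU * Λ ^ (18 / 5 : ℝ) + C₁ * (AU2 + AQ) * Λ ^ (11 / 5 : ℝ)) * R ^ (-(2 / 5) : ℝ) =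
      |ν| * ‖e‖ * AU * (m⁻¹ * C₂ * (Λ ^ (13 / 5 : ℝ) * R ^ (-(2 / 5) : ℝ))) +
      2 * |a| * ‖e‖ * AU * (m⁻¹ * (Λ ^ (13 / 5 : ℝ) * R ^ (-(2 / 5) : ℝ))) +
      |a| * ‖e‖ * AU * (m⁻¹ * C₁ * (Λ ^ (18 / 5 : ℝ) * R ^ (-(2 / 5) : ℝ))) +
      ‖e‖ * AU2 * (m⁻¹ * C₁ * (Λ ^ (11 / 5 : ℝ) * R ^ (-(2 / 5) : ℝ))) +
      ‖e‖ * AQ * (m⁻¹ * C₁ * (Λ ^ (11 / 5 : ℝ) * R ^ (-(2 / 5) : ℝ))) := by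
    ring
  rw [hsplit, hP_part, hKR]
  linarith only [htri, t1, t2, t3, t4, t5]

/-- **The Liouville step (Tsai 1998, Lemma 2.1 last assertion, pp. 35–36, run with the weight
as on pp. 45–46): mollifications of `P − P̃` have zero gradient.** Let `(U, P)` be a Leray
profile with (4.3) `∫ |U|^{10/3} |y|^{-5/3} < ∞` and let `Q ∈ L^{5/3}_w` solve
`−ΔQ = ∂ᵢ∂ⱼ(UᵢUⱼ)` in `𝒟'`. Then for every bump `ψ` the mollification `ψ ⋆ (P − Q)` (a smooth
harmonic function) has identically vanishing gradient: by the fixed-scale estimate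
`|∂ₑ(ψ ⋆ (P − Q))(y)| ≤ K R^{-2/5}` for every probe radius `R ≥ 1`, and `R → ∞`.
[cite: Tsai1998, Lemma 2.1 (pp. 35–36) and §4 pp. 45–46] -/
theorem IsLerayProfile.fderiv_normed_convolution_sub_eq_zero (hprof : IsLerayProfile ν a U P)
    (hIU : ∫⁻ y, ‖U y‖ₑ ^ (10 / 3 : ℝ) * ‖y‖ₑ ^ (-(5 / 3) : ℝ) ≠ ⊤)
    {Q : ℝ³ → ℝ} (hQm : AEStronglyMeasurable Q volume)
    (hIQ : ∫⁻ y, ‖Q y‖ₑ ^ (5 / 3 : ℝ) * ‖y‖ₑ ^ (-(5 / 3) : ℝ) ≠ ⊤)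
    (hQ : ∀ φ : ℝ³ → ℝ, ContDiff ℝ (⊤ : ℕ∞) φ → HasCompactSupport φ →
      ∫ y, Q y * (Δ φ) y = -∫ y, fderiv ℝ (fderiv ℝ φ) y (U y) (U y))
    (ψ : ContDiffBump (0 : ℝ³)) (y e : ℝ³) :
    fderiv ℝ (ψ.normed volume ⋆[lsmul ℝ ℝ, volume] fun x => P x - Q x) y e = 0 := by
  -- exponents and basic regularity
  have hpq₁ : (10 / 3 : ℝ).HolderConjugate (10 / 7) := ⟨by norm_num, by norm_num, by norm_num⟩
  have hpq₂ : (5 / 3 : ℝ).HolderConjugate (5 / 2) := ⟨by norm_num, by norm_num, by norm_num⟩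
  have hα : (0 : ℝ) < 5 / 3 := by norm_num
  have hU1 : ContDiff ℝ 1 U := hprof.contDiff_velocity.of_le one_le_two
  have hP1 := hprof.contDiff_pressure
  have hUm : AEStronglyMeasurable U volume := hU1.continuous.aestronglyMeasurable
  have hU2m : AEStronglyMeasurable (fun x => ‖U x‖ ^ 2) volume :=
    (hU1.continuous.norm.pow 2).aestronglyMeasurable
  have hIU2 : ∫⁻ x, ‖(‖U x‖ ^ 2)‖ₑ ^ (5 / 3 : ℝ) * ‖x‖ₑ ^ (-(5 / 3) : ℝ) ≠ ⊤ := by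
    have h : ∀ x, ‖(‖U x‖ ^ 2)‖ₑ ^ (5 / 3 : ℝ) = ‖U x‖ₑ ^ (10 / 3 : ℝ) := fun x => by
      rw [Real.enorm_eq_ofReal (sq_nonneg _), ENNReal.ofReal_pow (norm_nonneg _), ofReal_norm,
        ← ENNReal.rpow_natCast, ← ENNReal.rpow_mul]
      norm_num
    simp_rw [h]
    exact hIU
  -- the three ball bounds of §1
  have hballU : ∀ ϱ : ℝ, 0 < ϱ → IntegrableOn U (closedBall (0 : ℝ³) ϱ) ∧
      ∫ x in closedBall (0 : ℝ³) ϱ, ‖U x‖ ≤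
        ((∫⁻ x, ‖U x‖ₑ ^ (10 / 3 : ℝ) * ‖x‖ₑ ^ (-(5 / 3) : ℝ)) ^ (1 / (10 / 3 : ℝ)) *
          volume (ball (0 : ℝ³) 1) ^ (1 / (10 / 7 : ℝ))).toReal * ϱ ^ (13 / 5 : ℝ) := fun ϱ hϱ => by
    have h := setIntegral_norm_closedBall_le_weighted hUm hpq₁ hα hIU hϱ
    exact ⟨h.1, h.2.trans_eq (by norm_num)⟩
  have hballU2 : ∀ ϱ : ℝ, 0 < ϱ → IntegrableOn (fun x => ‖U x‖ ^ 2) (closedBall (0 : ℝ³) ϱ) ∧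
      ∫ x in closedBall (0 : ℝ³) ϱ, ‖(‖U x‖ ^ 2)‖ ≤
        ((∫⁻ x, ‖(‖U x‖ ^ 2)‖ₑ ^ (5 / 3 : ℝ) * ‖x‖ₑ ^ (-(5 / 3) : ℝ)) ^ (1 / (5 / 3 : ℝ)) *
          volume (ball (0 : ℝ³) 1) ^ (1 / (5 / 2 : ℝ))).toReal * ϱ ^ (11 / 5 : ℝ) := fun ϱ hϱ => by
    have h := setIntegral_norm_closedBall_le_weighted hU2m hpq₂ hα hIU2 hϱ
    exact ⟨h.1, h.2.trans_eq (by norm_num)⟩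
  have hballQ : ∀ ϱ : ℝ, 0 < ϱ → IntegrableOn Q (closedBall (0 : ℝ³) ϱ) ∧
      ∫ x in closedBall (0 : ℝ³) ϱ, ‖Q x‖ ≤
        ((∫⁻ x, ‖Q x‖ₑ ^ (5 / 3 : ℝ) * ‖x‖ₑ ^ (-(5 / 3) : ℝ)) ^ (1 / (5 / 3 : ℝ)) *
          volume (ball (0 : ℝ³) 1) ^ (1 / (5 / 2 : ℝ))).toReal * ϱ ^ (11 / 5 : ℝ) := fun ϱ hϱ => by
    have h := setIntegral_norm_closedBall_le_weighted hQm hpq₂ hα hIQ hϱ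
    exact ⟨h.1, h.2.trans_eq (by norm_num)⟩
  -- `P - Q` is weakly harmonic
  have hQl : LocallyIntegrable Q volume := locallyIntegrable_of_weighted hQm hpq₂ hα hIQ
  have hharm : ∀ φ : ℝ³ → ℝ, ContDiff ℝ (⊤ : ℕ∞) φ → HasCompactSupport φ →
      ∫ x, (P x - Q x) * (Δ φ) x = 0 := by
    intro φ hφ hφc
    have hΔc : Continuous (Δ φ) := FluidPDE.continuous_laplacian (contDiff_infty.1 hφ 2)
    have hΔs : HasCompactSupport (Δ φ) :=
      hφc.mono' fun x hx => by
        contrapose! hx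
        simp [FluidPDE.laplacian_eq_zero_of_notMem_tsupport hx]
    have i1 : Integrable fun x => P x * (Δ φ) x :=
      (hP1.continuous.mul hΔc).integrable_of_hasCompactSupport hΔs.mul_left
    have i2 : Integrable fun x => Q x * (Δ φ) x := by
      simpa only [smul_eq_mul] using hQl.integrable_smul_right_of_hasCompactSupport hΔc hΔs
    simp_rw [sub_mul]
    rw [integral_sub i1 i2, hprof.integral_pressure_mul_laplacian_eq_neg_integral_hessian hφ hφc,
      hQ φ hφ hφc, sub_self]
  -- constants and the fixed-scale estimate
  obtain ⟨⟨C₁, hC₁⟩, ⟨C₂, hC₂⟩⟩ := exists_bound_baseBump_derivs (E := ℝ³)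
  have hC₁0 : 0 ≤ C₁ := (norm_nonneg _).trans (hC₁ 0)
  have hC₂0 : 0 ≤ C₂ := (abs_nonneg _).trans (hC₂ 0)
  obtain ⟨K, hK⟩ : ∃ K : ℝ, ∀ R : ℝ, 1 ≤ R →
      |fderiv ℝ (ψ.normed volume ⋆[lsmul ℝ ℝ, volume] fun x => P x - Q x) y e| ≤
        K * R ^ (-(2 / 5) : ℝ) :=
    ⟨_, fun R hR => hprof.abs_fderiv_normed_convolution_sub_le hQl hharm ENNReal.toReal_nonneg
      ENNReal.toReal_nonneg ENNReal.toReal_nonneg hballU hballU2 hballQ hC₁ hC₂ hC₁0 hC₂0 ψ y e hR⟩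
  -- let `R → ∞`
  have hlim : Tendsto (fun R : ℝ => K * R ^ (-(2 / 5) : ℝ)) atTop (𝓝 0) := by
    simpa using (tendsto_rpow_neg_atTop (by norm_num : (0 : ℝ) < 2 / 5)).const_mul K
  have hle : |fderiv ℝ (ψ.normed volume ⋆[lsmul ℝ ℝ, volume] fun x => P x - Q x) y e| ≤ 0 :=
    ge_of_tendsto hlim (eventually_atTop.2 ⟨1, fun R hR => hK R hR⟩)
  exact abs_nonpos_iff.1 hle

end MainEstimate

/-! ## §5. `P − P̃` is constant; the reduction of `tsai1998_pressure_L53w` to the weighted Riesz bound -/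

section Assembly

variable {ν a : ℝ} {U : ℝ³ → ℝ³} {P : ℝ³ → ℝ}

/-- **Tsai 1998, §4 pp. 45–46 ("`P̃` differs from `P` only by a constant"), for the tree's
profile class.** Let `(U, P)` be a Leray profile with (4.3) and let `Q ∈ L^{5/3}_w`
(a.e.-strongly measurable, `∫ |Q|^{5/3} |y|^{-5/3} < ∞`) solve `−ΔQ = ∂ᵢ∂ⱼ(UᵢUⱼ)` in `𝒟'(ℝ³)`.
Then `P − Q` is a.e. equal to a constant. Proof: every mollification `φₖ ⋆ (P − Q)` has zero
gradient (`fderiv_normed_convolution_sub_eq_zero`), hence is constant, and `φₖ ⋆ (P − Q) → P − Q`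
a.e. along a mollifier sequence (Lebesgue differentiation). [cite: Tsai1998, §4 pp. 45–46] -/
theorem IsLerayProfile.exists_sub_ae_eq_const (hprof : IsLerayProfile ν a U P)
    (hIU : ∫⁻ y, ‖U y‖ₑ ^ (10 / 3 : ℝ) * ‖y‖ₑ ^ (-(5 / 3) : ℝ) ≠ ⊤)
    {Q : ℝ³ → ℝ} (hQm : AEStronglyMeasurable Q volume)
    (hIQ : ∫⁻ y, ‖Q y‖ₑ ^ (5 / 3 : ℝ) * ‖y‖ₑ ^ (-(5 / 3) : ℝ) ≠ ⊤)
    (hQ : ∀ φ : ℝ³ → ℝ, ContDiff ℝ (⊤ : ℕ∞) φ → HasCompactSupport φ →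
      ∫ y, Q y * (Δ φ) y = -∫ y, fderiv ℝ (fderiv ℝ φ) y (U y) (U y)) :
    ∃ c : ℝ, ∀ᵐ x ∂(volume : Measure ℝ³), P x - Q x = c := by
  have hpq₂ : (5 / 3 : ℝ).HolderConjugate (5 / 2) := ⟨by norm_num, by norm_num, by norm_num⟩
  have hQl : LocallyIntegrable Q volume := locallyIntegrable_of_weighted hQm hpq₂ (by norm_num) hIQ
  set g : ℝ³ → ℝ := fun x => P x - Q x with hg_def
  have hgl : LocallyIntegrable g volume :=
    hprof.contDiff_pressure.continuous.locallyIntegrable.sub hQl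
  obtain ⟨φ, hφ0, hφ2⟩ := FunctionSpaces.exists_contDiffBump_seq (E := ℝ³)
  -- each mollification is constant
  have hconst : ∀ k x, ((φ k).normed volume ⋆[lsmul ℝ ℝ, volume] g) x =
      ((φ k).normed volume ⋆[lsmul ℝ ℝ, volume] g) 0 := by
    intro k x
    have hdiff : Differentiable ℝ ((φ k).normed volume ⋆[lsmul ℝ ℝ, volume] g) :=
      ((φ k).hasCompactSupport_normed.contDiff_convolution_left _
        ((φ k).contDiff_normed (n := 1)) hgl).differentiable one_ne_zero
    have hzero : ∀ y, fderiv ℝ ((φ k).normed volume ⋆[lsmul ℝ ℝ, volume] g) y = 0 := fun y => by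
      ext e
      exact hprof.fderiv_normed_convolution_sub_eq_zero hIU hQm hIQ hQ (φ k) y e
    exact is_const_of_fderiv_eq_zero hdiff hzero x 0
  have hlim := FunctionSpaces.ae_tendsto_normed_convolution hφ0 hφ2 hgl
  refine ⟨limUnder atTop fun k => ((φ k).normed volume ⋆[lsmul ℝ ℝ, volume] g) 0, ?_⟩
  filter_upwards [hlim] with x hx
  simp_rw [hconst _ x] at hx
  exact hx.limUnder_eq.symm

/-- **Reduction of Tsai's weighted `L^{5/3}` pressure bound to its harmonic-analysis input.**
The named fact `tsai1998_pressure_L53w` (Tsai 1998, §4 pp. 45–46: for a Leray profile with (4.3)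
there is a constant `c` with `∫ |P − c|^{5/3} |y|^{-5/3} ≤ C ∫ |U|^{10/3} |y|^{-5/3}`) follows from
the weighted Riesz-transform pressure `tsai1998_weightedRieszPressure` (Stein 1993, Ch. V: the
existence of `P̃ ∈ L^{5/3}_w` solving `−ΔP̃ = ∂ᵢ∂ⱼ(UᵢUⱼ)` with the norm bound): take `P̃ = Q` from
the fact, then `P − P̃` is a.e. a constant `c` by `exists_sub_ae_eq_const` (Tsai's "following the
proof of Lemma 2.1"), so `∫ |P − c|^{5/3} w = ∫ |P̃|^{5/3} w ≤ C ∫ |U|^{10/3} w` with the SAME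
constant. This is the whole printed argument of pp. 45–46 except the sentence invoking
[St2, pp. 204–211], which is the hypothesis. [cite: Tsai1998, §4 pp. 45–46 (construction of P̃ before Lemma 4.1)] -/
theorem tsai1998_pressure_L53w_of_weightedRiesz (h : tsai1998_weightedRieszPressure) :
    tsai1998_pressure_L53w := by
  obtain ⟨C, hC⟩ := h
  refine ⟨C, fun ν a _ _ U P hprof hU => ?_⟩
  obtain ⟨Q, hQm, hQbound, hQeq⟩ := hC hprof.contDiff_velocity.continuous hU
  have hIQ : ∫⁻ y, ‖Q y‖ₑ ^ (5 / 3 : ℝ) * ‖y‖ₑ ^ (-(5 / 3) : ℝ) ≠ ⊤ :=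
    (hQbound.trans_lt (ENNReal.mul_lt_top ENNReal.coe_lt_top hU)).ne
  obtain ⟨c, hc⟩ := hprof.exists_sub_ae_eq_const hU.ne hQm hIQ hQeq
  refine ⟨c, ?_⟩
  have hae : ∀ᵐ y ∂(volume : Measure ℝ³), ‖P y - c‖ₑ ^ (5 / 3 : ℝ) * ‖y‖ₑ ^ (-(5 / 3) : ℝ) =
      ‖Q y‖ₑ ^ (5 / 3 : ℝ) * ‖y‖ₑ ^ (-(5 / 3) : ℝ) := by
    filter_upwards [hc] with y hy
    rw [show P y - c = Q y by linarith]
  rw [lintegral_congr_ae hae]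
  exact hQbound

end Assembly

end Literature.Analysis.FluidPDE

end
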